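import Summits.PneNP.PneNP.Theses.PhaseTwins
import Summits.PneNP.PneNP.Theorems.PhaseTwinsMacroscopicTwinsAboveDefs
import Literature.ModelTheory.FiniteModelTheory.CkEquivHomCount

set_option linter.dupNamespace false

/-!
# Disproof of `MacroscopicTwinsAbove` (stmt-PneNP-2720) — findings of the standing adversary (cdisprove)

Crux (`Summit.PneNP.PneNP.Theses.PhaseTwins.MacroscopicTwinsAbove`, route PhaseTwins, crux #3, rank 3):
`∀ Δ ≥ 3, ∀ λ > λ_c(Δ) = (Δ-1)^{Δ-1}/(Δ-2)^Δ, ∃ δ > 0, ∀ k, ∃ n ≥ 1, ∃ G H` on `Fin n` of max degree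
`≤ Δ`, hom-indistinguishable over treewidth `< k` (⟺ `G ≡_{C^k} H`, Dvořák bridge PROVED in the tree:
`Dvorak2010_ckEquiv_iff_homCount_holds`), with `e^{δ n} · Z_H(λ) ≤ Z_G(λ)`,
`Z_X(λ) = Σ_{I independent in X} λ^{|I|}` (`Z` below is that inlined sum, `crux_iff` is `Iff.rfl`).

## Verdict after cycle 3 (gen 3, 2026-08-16): still NOT refuted — and now a kernel-checked REDUCTION of the crux to seven stubs exists

Cycle-3 additions: §(d) (Targets = the seven stubs of the lead's PICKED line `literal-gadgets-cfi-apparatus`, attacked one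
by one: 0 broken, 3 hypotheses certified load-bearing), §(phys) (the density gap above `λ_c` is IN PRINT at the level of
local statistics — no "second threshold" there), Negative/SectorCoupling.lean. Cycle-2 additions: §(a′), §(c′), §(lit).

### WHY it resists (cycle 1; in cycle 3 the reconstruction below BECAME the lead's picked skeleton, see §(d))

Read back symbol by symbol (NOTES.md §Read-back): no junk — `treewidth` is an honest attained infimum,
`Nat.card (F →g G)` a genuine finite count, `λ_c(3) = 4`, `λ_c(4) = 27/16` (`lamC_three`), the `ℕ`-subtraction
junk of the threshold formula (`λ_c(0) = 1`, `λ_c(1) = -1`, `λ_c(2) = 0`) is fenced off by `3 ≤ Δ`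
(and IS load-bearing: `false_without_degreeFloor`), `0 < n` fences off the empty witness (`withoutPosN_trivial`).
The content is exactly the quantifier order `∃ δ ∀ k`: the swapped form `∀ k ∃ δ` is the constant-factor support
stmt-PneNP-2726 in disguise (`swapped_of_constantFactorTwins`, `δ := log 2 / n`).

A refutation must PROVE a continuity theorem above the uniqueness threshold: some `(Δ, λ > λ_c(Δ))` at which the
`C^k`-type pins the free-energy density `(1/n) log Z` to `o(1)` as `k → ∞`. Nothing in print or in the physics
points that way, and after trying to locate the conjectured "second threshold" in `(λ_c, λ₀)` I believe there is
none — here is the adversary's best reconstruction of a PROOF, for the provers (every named ingredient exists):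
1. TWINS WITH `Θ(n)` CHARGES. Atserias–Dawar 2019 Thm 8 (PROVED in the tree: `AtseriasDawar2019_xorLocalGap_holds`,
   `AtseriasDawar2019_thm8_family`): doubled 3XOR systems `I⁰ = G(S⁰)` (satisfiable) and `I¹ = G(S)` (EVERY
   assignment violates `≥ (1/2 − ε)` of the constraints), `I⁰ ≡_{C^k} I¹`, on the doubled variable set
   `Fin n × 𝔽₂` with `n = O(k)` — so Duplicator's strategy is made of CFI-style block flips `(x,0) ↔ (x,1)`, the
   shape that `CkEquivTransfer.ckEquiv_of_consistencyFamily` / the `parity-wired-ports` Duplicator stub transports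
   through a block-wise gadget wiring (one gadget copy `g_{x,a}` per doubled variable). CFI/Tseitin parity twins
   will NOT do (one violated vertex only): see the defect bound in §(b).
2. CONSTANT GADGETS ARE IN PRINT FOR THE WHOLE NON-UNIQUENESS REGION. Cai–Galanis–Goldberg–Guo–Jerrum–Štefankovič–
   Vigoda, *#BIS-hardness for 2-spin systems on bipartite bounded degree graphs in the tree non-uniqueness region*
   (RANDOM 2014 / JCSS 2016; arXiv:1311.4451, read pp. 7, 16): Def. 6 ("supports nearly-independent phase-correlated
   spins": for EVERY number `t` of terminals and every `ε` a bipartite max-degree-`Δ` gadget of size `n(t, ε)` whose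
   terminal spins, CONDITIONED ON THE PHASE `±`, have joint law within RATIO `1 ± ε` of the product measure `Q^{±}`,
   phases balanced by Def. 7/Lemma 8) and Lemma 9: "for all `Δ ≥ 3` … if the infinite `Δ`-regular tree is in the
   non-uniqueness region then the parameters support balanced nearly-independent phase-correlated spins" (hard-core:
   all `λ > λ_c(Δ)`; GGŠVY11 for `Δ = 3, Δ ≥ 6`, GŠV12 for `Δ = 4, 5`, p. 16). With `t, ε` FIXED this is a CONSTANT-size
   gadget; the same follows from the tree's vendored `slyGadgetReduction` by fixing its size parameter `N := N₀` and
   restricting to `κ = O(1)` ports (`SlyPropB.restrict`). Because connectors touch only terminals, `Z` of the wired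
   graph is EXACTLY `Σ_Y Π_v Z_v(Y_v)·E_{⊗Q^{Y}}[connector weights]·(1±ε)^{2|V|}` and the expectation FACTORISES over
   connectors: an effective Hamiltonian on the phase vector with constant couplings. The item text's worry "GŠV
   gadgets have `n^θ` ports, hence only `e^{o(n)}` gaps" is an artefact of exact MAX-CUT decoding.
3. ENERGY. Given the phases `Y`, ports are `ε`-independent with laws `q^{±}`, so each connector contributes a
   factor whose logarithm differs between phase patterns by `g(λ) > 0` iff `q⁺ ≠ q⁻` iff `λ > λ_c` (the sibling
   skeleton's `stub_chargeVisible`: `F₀ − F₁ = λ⁴(q⁺−q⁻)³`, numerically `g = 1.6·10⁻⁷` at `λ = 4.0004`, `Δ = 3`);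
   `κ` parallel connectors give coupling `β = κ g`. Planted side: `log Z ≥ const + β·|C|`; gap side:
   `log Z ≤ const + |V| log 2 + β(1/2+ε)|C|`; with `|C| = r|V|`, `β r (1/2 − ε) > log 2` — i.e. `κ ≳ 1/g(λ)`, a
   (huge) CONSTANT — gives `log Z_G − log Z_H ≥ c·|V| = c'·n_total` since every block has constant size.
   So `δ(λ) → 0` as `λ ↓ λ_c` (like `g(λ)`), but stays positive: no second threshold.
The genuine obstacles are combinatorial and UNIFORM in `λ`: (i) OCCURRENCE numbers `d_v` in the AD19 systems (its
Lemma 5 expanders are only left-regular — the fact's docstring says so, and `AtseriasDawar2019_xorLocalGap` exposes no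
occurrence statistics): the graph DEGREE is not the issue (it is set by the gadgets: interior `Δ`, terminals `Δ−1`
plus one connector edge, connector vertices `≤ 3`), but variable `v` needs `t_v = κ·d_v` terminals, i.e. a gadget of
size `n(t_v, ε) = poly(d_v)`; the total stays `O(n)` iff `Σ_v d_v^{O(1)} = O(n)` (true for random systems; for a
constant block size one wants bounded column sums — biregular unique-neighbour expanders — or an occurrence-splitting
step preserving `k`-local consistency); (ii) Duplicator through the wiring (block flips; the sibling line's
`stub_duplicator` pattern / `ckEquiv_of_consistencyFamily`); (iii) the connector bookkeeping (Sly's Lemma 2.2 for the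
wiring = `stub_connector` of the sibling line; with Def. 6's RATIO guarantee it is an exact factorisation up to
`(1±ε)^{2|V|}`). Reviewer 06866592's caveat "open at EVERY λ for small Δ (degree reduction)" is answered by (i):
gadgets exist for every `Δ ≥ 3` and carry the degree bound themselves. A kill here would be a new theorem of statistical physics, not a
cheap counterexample; no finite computation bears on an `∃ n`-statement of this shape; small-`k` slices (`k ≤ 2`)
are trivially satisfiable (route review r-54338091) and are not evidence either way.

## Findings (all `sorry`-free unless in §(e); axioms `propext`, `Classical.choice`, `Quot.sound`)

**(0) Shape of a refutation.** `not_crux_iff_densityContinuityAt`: `¬ MacroscopicTwinsAbove ↔ ∃ Δ ≥ 3, ∃ λ > λ_c(Δ),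
DensityContinuityAt Δ λ` (`∀ δ > 0 ∃ k`, `C^k`-equivalent max-degree-`Δ` graphs have `Z_G ≤ e^{δn} Z_H` — literally
the conclusion shape of support stmt-PneNP-2725 at one activity); with `densityContinuityAt_of_below` the pair
(2725, crux) is a dichotomy at `λ_c(Δ)` leaving only the critical point unclaimed. So a kill = a continuity
THEOREM at one supercritical activity; see the verdict above for why none is in sight.

**(a) Load-bearing hypotheses** (`Without…` defs + theorems):
* `0 < n` — `withoutPosN_trivial`: WITHOUT it the crux is trivially TRUE (`n = 0`, `G = H = ⊥`).
* `3 ≤ Δ` — `false_without_degreeFloor`: at `Δ = 0` (`λ_c(0) = 1 < 2 = λ`) max-degree-0 graphs all have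
  `Z = 3^n`, so no gap. (`Δ = 1, 2` are false too — 2-WL determines max-degree-2 graphs — not formalised.)
* `λ > λ_c(Δ)` — `false_without_threshold_of_densityContinuityBelow`: the all-`λ > 0` form contradicts the route's
  own support `DensityContinuityBelow` (stmt-PneNP-2725, BCKL 2013 Rem. 1 + Weitz 2006) at `Δ = 3, λ = 1`.
  Unconditionally (cluster expansion at `λ < 1/(e(Δ+1))`) — §(e), not formalised.
* hom-indistinguishability — `trivial_without_homIndist` [cycle 2]: without it the statement is trivially TRUE on two
  vertices for every `k` (`G = ⊥`, `H = K₂`, `δ = ½log((1+λ)²/(1+2λ))`; `Z_bot`, `Z_top_two`): the one hypothesis that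
  makes the crux non-trivial. Likewise `0 < δ` — `withoutPosDelta_trivial` [cycle 2] (`δ = 0`, `G = H`).
* `H.maxDegree ≤ Δ` — REDUNDANT, see §(a′) [cycle 2]. Summary of the table: dropping `0 < n` / `0 < δ` / `HomIndist`
  trivialises the crux, dropping `3 ≤ Δ` / `λ > λ_c` falsifies it, dropping `H`'s degree bound changes nothing.

**(b) Necessary conditions on witnesses / tightness:**
* `Z_le_pow_mul_Z_of_agree_off` (EDIT-DISTANCE BOUND): if `G`, `H` agree outside `S` then
  `Z_H ≤ (1+λ)^{|S|} Z_G`. Hence `defect_bound`: a witness needs `δ·n ≤ |S|·log(1+λ)` for EVERY set `S` outside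
  which the twins agree, under EVERY relabelling (`defect_bound_perm`); `delta_le_log`: `δ ≤ log(1+λ)` always;
  `delta_le_of_blocks`: `|S| ≤ s·M`, blocks of size `≥ b`, `M·b ≤ n` ⇒ `δ ≤ s·log(1+λ)/b`.
  CONSEQUENCES FOR CONSTRUCTIONS (the message to provers): twins must differ on `Ω(δn/log(1+λ))` vertices under
  the best alignment. A bare CFI pair `CFI(B,T)`, `CFI(B,T△{e})` agrees off the 4 ends of the two connecting
  edges at `e`, so its `Z`-ratio is `≤ (1+λ)^4` for EVERY base `B` and every `λ` (matching the computed identity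
  `Z_e − Z_o = ±2^{β₁}λ^{4|B|}` on stmt-PneNP-2726); disjoint unions of CFI pairs over bases `B_k` with
  `tw(B_k) ≥ k` have `b > k`, `s = 4`: `δ_k ≤ 4 log(1+λ)/k → 0` — useless here. Likewise ONE violated Tseitin
  vertex (the `parity-wired-ports` line of crux #2: the two charge classes differ, after gauge, only at the
  `10κ₂` complex vertices of one base vertex) gives `log(Z_G/Z_H) = O(κ₂ log(1+λ)) = o(n)`: a proof of THIS crux
  needs `Θ(n)` non-gaugeable charges (AD19 Thm 8-type systems), not CFI/Tseitin parity.
* `lt_card_of_witness`: every witness at depth `k` has `n > k` (pebble every vertex: `iso_of_ckEquiv_of_card_le`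
  + the PROVED Dvořák bridge + `Z_eq_of_iso`), so `n → ∞` is forced although not typed.
* `defect_bound_edges` [cycle 2, §(b′)]: `δn ≤ 2(|E(G)|+|E(H)|) log(1+λ)` (twins agree off their non-isolated
  vertices; `card_posDegree_le_twice_edges`) — witnesses need linearly many edges (total average degree
  `≥ δ/(2log(1+λ))`); no sparse / mostly-isolated witness families.

**(c) Natural strengthenings / weakenings:**
* `not_singlePair`: "one pair serves all `k`" is FALSE (by (b)).
* `swapped_of_constantFactorTwins`: the `∀ k ∃ δ` weakening follows from `ConstantFactorTwinsEverywhere`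
  (stmt-PneNP-2726) — it has no density content; the uniformity of `δ` in `k` is everything.

**(a′) [cycle 2] `H.maxDegree ≤ Δ` is REDUNDANT** (hypothesis mutation): for `k ≥ 2` hom-indistinguishability
transports the degree bound — `maxDegree_le_of_homIndist` (star counts `hom(K_{1,j},·)` lie between `(max deg)^j`
and `n (max deg)^j`: `pow_degree_le_card_hom_star`, `card_hom_star_le`; stars have treewidth `≤ 1`:
`treewidth_star_le`; `n Δ^j < (Δ+1)^j` at `j = nΔ+1`: `numeric_star`), hence `crux_iff_withoutDegH`: the crux is
EQUIVALENT to the form bounding only `G`'s degree (depths `k ≤ 1` are trivial either way). Not load-bearing; provers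
need certify one degree bound only, refuters may ignore the other. (By the symmetry of `HomIndist` the same holds
with `G`, `H` exchanged — but of course not for both bounds at once.)

**(c′) [cycle 2] NO UNIFORM `δ`** (natural strengthening, refuted): `lamC_le_div`: `λ_c(Δ) ≤ 8/(Δ−2)` (the typed
threshold `= (1/(Δ−2))(1+1/(Δ−2))^{Δ−1} ~ e/Δ`; `(1+1/d)^{d+1} ≤ e^{(d+1)/d} ≤ e² < 8`); with `delta_le_log`
(`δ ≤ log(1+λ) ≤ λ`) this kills `UniformDelta` = "one `δ > 0` for all `Δ ≥ 3`, `λ > λ_c(Δ)`" (`not_uniformDelta`: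
`Δ = d+2`, `d > 9/δ`, `λ = 9/d`). Quantitatively every witness has `δ(Δ,λ) ≤ log(1+λ)` with `λ` as small as
`8/(Δ−2)`: the density-gap constant necessarily degenerates in the large-degree/small-activity corner (as it must
physically: `δ → 0` as `λ ↓ λ_c(Δ)` is expected but NOT provable cheaply — that would be continuity AT `λ_c`).

**(lit) [cycle 2]** searchd rc 75 throughout (degraded); `lit galaxy` substring sweeps ("homomorphism
indistinguishab", "right-convergence") return the 7 hom-indistinguishability papers already logged by the planner
(Roberson–Seppelt, Seppelt, Rattan–Seppelt, Göbel–Goldberg–Roth, Schindling, NT–Maehara) plus right-convergence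
context (Borgs–Chayes–Lovász–Sós–Vesztergombi dense II; Salez, interpolation for prescribed degrees): nothing joins
`C^k`/WL-equivalence to `Z_G(λ)` above `λ_c`, in either direction. No counterexample family in print.

**(d) [cycle 3] TARGETS = the seven stubs of the PICKED line** `Lines/literal-gadgets-cfi-apparatus.lean` (lead
prover-line-stmt-PneNP-2720-0, PICKED.md; definitions LANDED as `Theorems/PhaseTwinsMacroscopicTwinsAboveDefs.lean`; the
composition `MacroscopicTwinsAbove_of` is kernel-checked from the stubs, so the crux now stands or falls with them).
No stuck stubs were handed over (payload.stuck_stubs = ∅), so every stub SIGNATURE got the cheap arsenal: degenerate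
parameters, dropped hypotheses, exact small-model brute force (kit job j011053 = `toy_stubs.py`, exact rationals; the
same run reproduced locally, output attached as `toy_stubs_output.json`), comparison with print. STATUS AT 04:23Z (lead's
evidence note): S4 `stub_maxDegree` p77122, S3 `stub_duplicator` p77861, S6 `stub_energy` p77972 (reshaped to (ii) only;
(i) = the landed `stub_chargeVisible`), S2 `stub_farSystems` p78034 (reshaped to `(s,½)`-expansion, SparseOrData supplier)
have LANDED — the kernel confirms the verdicts below for them; S5 parts 1–2 landed (p77654/p78021), part 3 pending; S7 in
progress (candidate proof attached by drefute-0); S1 = trust base. VERDICT PER STUB (0/7 broken; analysis done on the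
02:02Z signatures, the 03:46Z reshape only weakens S2's expansion constant and drops S6(i)):
* S1 `stub_slyGadgets` (trust base, = hypothesis `h21` of `slyGadgetReduction_of_gadgets`, shared with crux 2719): compared
  with the printed Sly 2010 Thm 2.1 (arXiv:1005.5584 p.8, materialised and read): (GpropA) "`P_G(Y=+) ≥ 1/n, P_G(Y=−) ≥ 1/n`"
  = `SlyPropA` verbatim; (GpropB) "`max_{σ_V} |P_G(σ_V | Y=±)/Q_V^±(σ_V) − 1| ≤ n^{−2θ}`" = `SlyPropB` verbatim — the
  SUP-RATIO form, which is exactly what makes S5 valid for every number of copies; `m = (d−1)^{⌊θ log_{d−1} n⌋}` ports of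
  degree `d−1`, "`(2+o(1))n` vertices" ⇒ `v ≤ 3n`. Printed under Sly's Condition 1.2; the `(d, λ)`-covering is the fact's
  cite line (GGŠVY Lemma 5 / Cor. 6, GŠV16 Lemma 4 + Lemma 19). Not attackable cheaply; survives.
* S2 `stub_farSystems`: re-derived. Lemma D: girth `> 12k` of the (6,3)-biregular incidence graph ⇒ any `|T| ≤ 6k`
  equations span a forest ⇒ `|N(T)| ≥ 2|T|+1` ⇒ unique-neighbour count `u ≥ 2|N(T)| − 3|T| ≥ |T| + 2` (and
  `XorSystem.boundary` IS the unique-neighbour set: `(T.filter (v ∈ S ·)).card = 1`); Lemma E: `2^{m/2}·2^{H(1/20)m} < 2^m`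
  ⇒ some `b` is `> m/20`-far, `η = 1/20`; `k = 0` degenerate case fine; `T = univ` forces `m > 6k`, i.e. the systems (hence
  the twins) grow with `k` — consistent with `lt_card_of_witness`. Survives.
* S3 `stub_duplicator`: an instance of the PROVED `ckEquiv_of_consistencyFamily` (Good := `XorSystem.Good (lgScope E) b s`,
  `K := K₀`, `c₀ := 3`, `φ := lgFlip E`; `isConsistencyFamily_good hq hexp hK₀` — CountingWidthXorHam.lean, exactly the
  stub's `hq/hexp/hK₀`; `hcompat` reduces by `CFIMatching.bit_shift` to `∂f e = b e` on pebbled scopes =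
  `Good.sum_scope_eq`, which needs the stub's `hs : 1 ≤ s`). The flip `lgFlipFun E f` IS an isomorphism
  `lgGraph b ≅ lgGraph (b + ∂f)`: brute force 40/40 random toys (j011053 T3) — and 40/40 also WITHOUT injective rows, so
  `hE` is NOT needed for the isomorphism; it IS needed for the consistency bookkeeping (with a doubled variable
  `E e = (x,x,z)` the graph enforces `z = b e` while `Good` sums over the SET `{x, z}`; on the system `{(x_e, x_e, z)}_e`
  with a mixed `b` the expansion hypothesis holds for EVERY `s` yet `lgGraph 0 ≇ lgGraph b`, so S3 minus `hE` is false —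
  paper argument, recorded for the S3 prover). Degenerate: `p = 0` makes `hexp` unsatisfiable once `m ≥ 1`; `k ≤ 1`
  trivial. Survives.
* S4 `stub_maxDegree`: case analysis re-done (copy vertex: `deg_G + 1`, the `+1` only at a port, which has `deg_G ≤ d−1`
  — uses `slot`/`Vp`/`Vm` injective, port ranges disjoint, `hloc`; end vertex `1 + 2` since `bit c S' i = a` has exactly
  two solutions `S'`; inner vertex `3`). Brute force (T3, path gadget `d = 3`): max degree `3` in 40/40 toys; WITHOUT `hloc`
  (all occurrence colours equal) degree up to `5` in 23/40 toys — `hloc` is load-bearing, as typed. Survives.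
* S5 `stub_connector` (the lead's own, L): its content is the exact identity `Z_𝔊(Y) = Σ_{(S_g)} [Π_g Z_G(Y_g ∧ σ_V = S_g)]
  · Wt((S_g))` with `Wt ≥ 0` a function of the port patterns only (pair indicators × per complex
  `Σ_{J indep} λ^{|J|} Π_{ends ∈ J}[port vacant]`), the TERMWISE two-sided `SlyPropB` bounds (valid for every `nv`, no
  hidden `nv ≤ n^{θ/4}`), and the factorisation of `E_Q[Wt]` over connectors (distinct connectors use distinct ports:
  `slot` injective + `hloc` + `Vp/Vm` disjoint) `= Π_x pairW · Π_e cxWeight^K = lgW · (1+λ)^{10mK}`, the `(1+λ)^{10mK}`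
  being exactly what the isolated complex vertices contribute to `Z_base(Y)` (normalisation of `cxW` ✓). No smell;
  survives (bookkeeping only).
* S6 `stub_energy`: (i) is LANDED (`ParityWiredPorts.stub_chargeVisible`, PhaseTwinsPolyDepthTwinsAboveChargeVisible.lean;
  T1 re-checks `F₀ − F₁ = λ⁴(q⁺−q⁻)³/(1+λ)^{10}` exactly at 5 parameter points). (ii) re-derived on paper for ALL parameters
  (including `K = 0`, `D = 0`, `t = 0`, non-injective rows): with `A` = aligned variables and `h` read off the anti-aligned
  ones, Tseitin covariance (T1: exact for all 64 patterns × 8 shifts) makes an untouched equation weigh `F_{b e + Σ_i h(E e i)}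
  ∈ {F₀, F₁}`, the `≤ D|A|` touched ones weigh `≤ F_max = ρ_F F_min ≤ ρ_F F₁` (`cxRho = F_max/F_min` by charge-independence
  of the extremes `cxW_const_eq` + monotonicity `cxWeight_mono`, both LANDED in PolyDepthTwinsAbove/Negative/
  TseitinGapCoupling.lean; T1 exact), untouched violations `u₁ ≥ t − |T|`, so `lgW b Y e^{Kt(Ψ0−Ψ1)}/lgW 0 ref ≤
  (B^{−κ₁} ρ_F^{KD})^{|A|} ≤ 1`. EXACT BRUTE FORCE (T2): every system with `nv ≤ 3`, `m ≤ 2` (injective or not), every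
  `b`, every `Y`, `t = min_f #violated`, `K ∈ {1,2}`, `κ₁` = least integer with `ρ_F^{KD} ≤ B^{κ₁}`, at `(λ,q⁺,q⁻) =
  (5,4/5,1/5), (1,1/2,1/3), (10,9/10,1/100)`: 3 × 2664 cases, 0 violations (also 0 with `κ₁ − 1`: the sector inequality is
  sufficient, not sharp); with `κ₁ = 0` ALL 2664 cases fail. LOAD-BEARING, formalised: `not_sectorOptWithoutCoupling`
  below (landed as Negative/SectorCoupling.lean): the sector hypothesis cannot be dropped. Survives.
* S7 `stub_parameters`: asymptotic arithmetic only (`K, κ₁ = O(log n)` against `slyM d θ n ≥ n^θ/(d−1)`; `slyM` typed with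
  `⌊·⌋₊`, harmless for `n ≥ 1`, `d ≥ 3`). Survives; provable now.
MESSAGE TO THE LEAD: the line is sound on paper; hypotheses certified load-bearing (do not try to drop them): S3.`hE`,
S4.`hloc`, S6(ii) sector inequality; the only input not provable now is S1, which is verbatim in print. The cycle-2
pre-checks stand (girth-twins Lemmas D/E sound; `fglss_maxDegree` F4 of IdeatorThreeSketch refuted by triager r1-1).

**(phys) [cycle 3] No second threshold at the level of LOCAL statistics (in print).** The item text allows that the crux
"may be FALSE in the window `(λ_c, λ₀)` — a second, density-determinacy threshold". At the Benjamini–Schramm level there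
is none, for any `d ≥ 3` and any `λ > λ_c(d)`: by MWW09 §4 / DFJ02 Claim 2.2 (quoted in Sly 2010 §1.3, arXiv:1005.5584
p.6, read) the first-moment exponent `Φ₁(α,β)` of the random BIPARTITE `d`-regular graph has its maxima on `T` exactly at
the off-diagonal points `(p⁺,p⁻), (p⁻,p⁺)` once `λ > λ_c`; since `Φ₁(α,α) = 2ψ(α)` with `ψ` the first-moment exponent of
the uniformly random `d`-regular graph (checked at `d = 1` by hand), Markov gives `(1/n) log Z ≤ sup_α ψ(α) + o(1) <
½ max_T Φ₁` a.a.s. for random `d`-regular graphs, while random bipartite `d`-regular graphs attain `½ max_T Φ₁ − o(1)`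
(Sly–Sun 2014 Thm 1(b), arXiv:1203.2602 p.5, read this cycle: for EVERY uniformly sparse, nearly bipartite sequence
converging locally to `T_d` the free energy density exists and equals the Bethe prediction `Φ(h⁺)` at the
semi-translation-invariant fixed point, i.e. `½ Φ₁(p⁺,p⁻) = ½ max_T Φ₁` (`Φ₁` is the first-moment = Bethe functional of
the bipartite `d`-regular ensemble, whose critical points on `T` are exactly the BP fixed points `(p^±,p^∓), (p*,p*)`:
MWW09 §4 as quoted by Sly); earlier MWW09 near `λ_c` by the second moment; for large `λ` already the trivial
`Z ≥ (1+λ)^{n}` of one side beats `sup_α ψ`). Numerically (grid `1/800` on `T`): `d = 3`: `λ = 4.5` gives `½(max_T Φ₁ − sup_α Φ₁(α,α)) = 1.07·10⁻³` per vertex,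
`λ = 5`: `3.6·10⁻³`, `λ = 8`: `2.6·10⁻²`; `d = 4, λ = 2`: `2.5·10⁻³`; `d = 5, λ = 1.2`: `1.5·10⁻³`; just above `λ_c(3) = 4`
(`λ = 4.02`) `2·10⁻⁶` and below it (`λ = 3.5`) the maximum sits ON the diagonal — the BS-level gap opens continuously at
`λ_c`, as the crux's `δ(Δ,λ)` should. Both sequences converge locally to `T_d`, so `r`-ball censuses — the level
of the partner support `DensityContinuityBelow` (BCKL13 Rem. 1) — do NOT pin `(1/n) log Z` anywhere above `λ_c`. This is
evidence, not an implication (`C³` already separates bipartite from non-bipartite via odd closed walks, treewidth 2):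
the crux is the `C^k`-upgrade of this gap, which is what the XOR/CFI apparatus of the line manufactures.

**(e) Near-misses / not formalised:** `false_without_threshold` UNCONDITIONALLY (cluster expansion: for
`λ < 1/(e(Δ+1))`, `|log Z_G − log Z_H| ≤ 2n(cλ)^k` for `C^k`-equivalent max-degree-`Δ` graphs, since truncated
cluster sums are linear combinations of hom counts from connected graphs on `< k` vertices) — needs a convergent
cluster expansion in the tree; stated with `sorry` below as a marker, not used anywhere.

Landed / filed: `Negative/DefectBound.lean` (p73833, ACCEPTED: §(b) + `lt_card_of_witness`, `not_singlePair`);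
`Negative/LoadBearing.lean` (§(a) incl. `trivial_without_homIndist`/`withoutPosDelta_trivial`, §(0), swapped form;
gen-1 p74097/p74324 bounced ONLY by the 2026-08-16 gate restart — re-filed by gen 2 as p76233, ACCEPTED 315b360154af);
`Negative/NoUniformDelta.lean` (§(c′) `lamC_le_div`/`not_uniformDelta`, §(b′) `defect_bound_edges`; p76238, ACCEPTED
505660eb6a71); `Negative/StarDegree.lean` (§(a′) `maxDegree_le_of_homIndist`,
`not_macroscopicTwinsAbove_iff_not_withoutDegH`; p76243, ACCEPTED bf88de3e9461); [cycle 3] `Negative/SectorCoupling.lean`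
(§(d): `cxWeight_strictMono`, `cxW_ref_lt_allMinus`, `sectorOpt_false_without_coupling{,_any}`,
`lgW_ref_lt_allMinus_zero_coupling`, `not_sectorOptWithoutCoupling` over the LANDED `lgW/lgRef`, theorems only; p80502,
submitted 04:58Z). Importers: `import Summits.PneNP.PneNP.Theorems.MacroscopicTwinsAbove.Negative.<File>`,
namespace `Summit.PneNP.PneNP.Theorems.MacroscopicTwinsAbove.Negative` (this work file keeps self-contained copies).
Evidence/computations used: [cycle 3] kit job j011053 (`toy_stubs.py`: T1 complex-factor table, T2 exact brute force
of S6(ii) and of its sector-free variant, T3 degree bound / flip isomorphism; attached to the item); no finite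
computation bears on the `∃ n`-crux itself; cited: route-review computation on stmt-PneNP-2726 (CFI identity),
sibling skeleton `parity-wired-ports` (value of `g`), Sly 2010 pp. 6, 8 (read this cycle).
-/

namespace Summit.PneNP.PneNP.Cruxes.MacroscopicTwinsAbove.Disproof

open scoped Classical BigOperators
open Finset

/-- The hard-core partition function `Z_G(λ) = Σ_{I independent} λ^{|I|}`, literally the sum
inlined in the crux. -/
noncomputable def Z {n : ℕ} (G : SimpleGraph (Fin n)) (lam : ℝ) : ℝ :=
  ∑ I : Finset (Fin n), if G.IsIndepSet (↑I : Set (Fin n)) then lam ^ I.card else 0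

theorem Z_eq_sum_filter {n : ℕ} (G : SimpleGraph (Fin n)) (lam : ℝ) :
    Z G lam = ∑ I ∈ (univ : Finset (Finset (Fin n))).filter
      (fun I : Finset (Fin n) => G.IsIndepSet (↑I : Set (Fin n))), lam ^ I.card := by
  rw [Z, Finset.sum_filter]

/-- `Z_G(λ) ≥ 1` for `λ ≥ 0` (the empty set is independent). -/
theorem one_le_Z {n : ℕ} (G : SimpleGraph (Fin n)) {lam : ℝ} (hlam : 0 ≤ lam) : 1 ≤ Z G lam := by
  have hterm : ∀ I ∈ (univ : Finset (Finset (Fin n))),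
      0 ≤ (if G.IsIndepSet (↑I : Set (Fin n)) then lam ^ I.card else 0) := fun I _ => by
    split_ifs <;> positivity
  have h := Finset.single_le_sum hterm (Finset.mem_univ (∅ : Finset (Fin n)))
  have hempty : G.IsIndepSet (↑(∅ : Finset (Fin n)) : Set (Fin n)) := by
    simp [SimpleGraph.isIndepSet_iff, Set.Pairwise]
  simp only [hempty, if_true, Finset.card_empty, pow_zero] at h
  exact h

theorem Z_pos {n : ℕ} (G : SimpleGraph (Fin n)) {lam : ℝ} (hlam : 0 ≤ lam) : 0 < Z G lam :=
  lt_of_lt_of_le one_pos (one_le_Z G hlam)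

/-- `Z_G(λ) ≤ (1+λ)^n` for `λ ≥ 0`. -/
theorem Z_le_pow {n : ℕ} (G : SimpleGraph (Fin n)) {lam : ℝ} (hlam : 0 ≤ lam) :
    Z G lam ≤ (1 + lam) ^ n := by
  have h1 : Z G lam ≤ ∑ I : Finset (Fin n), lam ^ I.card := by
    refine Finset.sum_le_sum fun I _ => ?_
    split_ifs
    · exact le_rfl
    · positivity
  have h2 : ∑ I : Finset (Fin n), lam ^ I.card = (1 + lam) ^ n := by
    have := Fintype.sum_pow_mul_eq_add_pow (Fin n) lam 1
    simp only [one_pow, mul_one, Fintype.card_fin] at this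
    rw [this, add_comm]
  linarith

/-- **Edit-distance bound.** If `G` and `H` have the same adjacency outside a vertex set `S`,
then `Z_H(λ) ≤ (1+λ)^{|S|} · Z_G(λ)`: split an `H`-independent set `I` as `(I ∩ S) ⊔ (I \ S)`;
the second part is `G`-independent. -/
theorem Z_le_pow_mul_Z_of_agree_off {n : ℕ} (G H : SimpleGraph (Fin n)) (S : Finset (Fin n))
    (hagree : ∀ u v, u ∉ S → v ∉ S → (G.Adj u v ↔ H.Adj u v)) {lam : ℝ} (hlam : 0 ≤ lam) :
    Z H lam ≤ (1 + lam) ^ S.card * Z G lam := by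
  set T : Finset (Finset (Fin n)) :=
    univ.filter (fun J : Finset (Fin n) => J ∩ S = ∅ ∧ G.IsIndepSet (↑J : Set (Fin n))) with hT
  set IH : Finset (Finset (Fin n)) :=
    univ.filter (fun I : Finset (Fin n) => H.IsIndepSet (↑I : Set (Fin n))) with hIH
  set IG : Finset (Finset (Fin n)) :=
    univ.filter (fun I : Finset (Fin n) => G.IsIndepSet (↑I : Set (Fin n))) with hIG
  have hZH : Z H lam = ∑ I ∈ IH, lam ^ I.card := by rw [Z, Finset.sum_filter]
  have hZG : Z G lam = ∑ I ∈ IG, lam ^ I.card := by rw [Z, Finset.sum_filter]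
  let φ : Finset (Fin n) → Finset (Fin n) × Finset (Fin n) := fun I => (I ∩ S, I \ S)
  have hinj : ∀ I ∈ IH, ∀ I' ∈ IH, φ I = φ I' → I = I' := by
    intro I _ I' _ h
    simp only [φ, Prod.mk.injEq] at h
    rw [← Finset.sdiff_union_inter I S, ← Finset.sdiff_union_inter I' S, h.1, h.2]
  have himage : IH.image φ ⊆ S.powerset ×ˢ T := by
    intro p hp
    rw [Finset.mem_image] at hp
    obtain ⟨I, hI, rfl⟩ := hp
    rw [hIH, Finset.mem_filter] at hI
    simp only [φ, Finset.mem_product, Finset.mem_powerset, hT, Finset.mem_filter,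
      Finset.mem_univ, true_and]
    refine ⟨Finset.inter_subset_right, ?_, ?_⟩
    · ext x
      simp
    · intro u hu v hv huv
      have hu' := Finset.mem_sdiff.1 (Finset.mem_coe.1 hu)
      have hv' := Finset.mem_sdiff.1 (Finset.mem_coe.1 hv)
      rw [hagree u v hu'.2 hv'.2]
      exact hI.2 hu'.1 hv'.1 huv
  calc Z H lam = ∑ I ∈ IH, lam ^ I.card := hZH
    _ = ∑ I ∈ IH, (fun p : Finset (Fin n) × Finset (Fin n) =>
          lam ^ p.1.card * lam ^ p.2.card) (φ I) := by
        refine Finset.sum_congr rfl fun I _ => ?_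
        simp only [φ]
        rw [← pow_add, Finset.card_inter_add_card_sdiff]
    _ = ∑ p ∈ IH.image φ, lam ^ p.1.card * lam ^ p.2.card :=
        (Finset.sum_image (f := fun p : Finset (Fin n) × Finset (Fin n) =>
          lam ^ p.1.card * lam ^ p.2.card) hinj).symm
    _ ≤ ∑ p ∈ S.powerset ×ˢ T, lam ^ p.1.card * lam ^ p.2.card :=
        Finset.sum_le_sum_of_subset_of_nonneg himage fun p _ _ => by positivity
    _ = (∑ A ∈ S.powerset, lam ^ A.card) * ∑ J ∈ T, lam ^ J.card := by
        rw [Finset.sum_product, Finset.sum_mul_sum]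
    _ = (1 + lam) ^ S.card * ∑ J ∈ T, lam ^ J.card := by
        congr 1
        have := Finset.sum_pow_mul_eq_add_pow lam 1 S
        simp only [one_pow, mul_one] at this
        rw [this, add_comm]
    _ ≤ (1 + lam) ^ S.card * Z G lam := by
        rw [hZG]
        refine mul_le_mul_of_nonneg_left ?_ (by positivity)
        refine Finset.sum_le_sum_of_subset_of_nonneg ?_ fun J _ _ => by positivity
        intro J hJ
        rw [hT, Finset.mem_filter] at hJ
        rw [hIG, Finset.mem_filter]
        exact ⟨Finset.mem_univ _, hJ.2.2⟩


/-! ### Consequences for witnesses of the crux -/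

/-- `Z` is invariant under relabelling the vertices (pull back along a permutation). -/
theorem Z_comap_equiv {n : ℕ} (H : SimpleGraph (Fin n)) (σ : Fin n ≃ Fin n) (lam : ℝ) :
    Z (H.comap σ) lam = Z H lam := by
  unfold Z
  refine Fintype.sum_equiv (Equiv.finsetCongr σ) _ _ fun I => ?_
  have hiff : (H.comap σ).IsIndepSet (↑I : Set (Fin n)) ↔
      H.IsIndepSet (↑(Equiv.finsetCongr σ I) : Set (Fin n)) := by
    rw [Equiv.finsetCongr_apply, Finset.coe_map, Equiv.coe_toEmbedding,
      SimpleGraph.isIndepSet_iff, SimpleGraph.isIndepSet_iff,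
      Set.InjOn.pairwise_image σ.injective.injOn]
    rfl
  rw [Equiv.finsetCongr_apply, Finset.card_map, ← Equiv.finsetCongr_apply]
  by_cases h : (H.comap σ).IsIndepSet (↑I : Set (Fin n))
  · rw [if_pos h, if_pos (hiff.1 h)]
  · rw [if_neg h, if_neg (fun h' => h (hiff.2 h'))]

/-- `Z` is an isomorphism invariant. -/
theorem Z_eq_of_iso {n : ℕ} {G H : SimpleGraph (Fin n)} (e : G ≃g H) (lam : ℝ) :
    Z G lam = Z H lam := by
  have hG : G = H.comap e.toEquiv := by
    ext u v
    exact (e.map_rel_iff).symm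
  rw [hG]
  exact Z_comap_equiv H e.toEquiv lam

/-- **Defect bound.** If `e^{δ n} · Z_H ≤ Z_G` and `G`, `H` agree outside `S`, then
`δ · n ≤ |S| · log (1 + λ)`. -/
theorem defect_bound {n : ℕ} {G H : SimpleGraph (Fin n)} {S : Finset (Fin n)}
    (hagree : ∀ u v, u ∉ S → v ∉ S → (G.Adj u v ↔ H.Adj u v)) {lam δ : ℝ} (hlam : 0 ≤ lam)
    (hgap : Real.exp (δ * n) * Z H lam ≤ Z G lam) :
    δ * n ≤ S.card * Real.log (1 + lam) := by
  have h1 : Z G lam ≤ (1 + lam) ^ S.card * Z H lam :=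
    Z_le_pow_mul_Z_of_agree_off H G S (fun u v hu hv => (hagree u v hu hv).symm) hlam
  have hZH := Z_pos H hlam
  have h2 : Real.exp (δ * n) ≤ (1 + lam) ^ S.card := le_of_mul_le_mul_right (hgap.trans h1) hZH
  have h3 : (1 + lam) ^ S.card = Real.exp (S.card * Real.log (1 + lam)) := by
    rw [Real.exp_nat_mul, Real.exp_log (by linarith)]
  rw [h3, Real.exp_le_exp] at h2
  exact h2

/-- The same after an arbitrary relabelling `σ` of `H`: twins with a macroscopic gap are far apart
in EDIT DISTANCE under every vertex bijection. -/
theorem defect_bound_perm {n : ℕ} {G H : SimpleGraph (Fin n)} (σ : Fin n ≃ Fin n)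
    {S : Finset (Fin n)}
    (hagree : ∀ u v, u ∉ S → v ∉ S → (G.Adj u v ↔ H.Adj (σ u) (σ v))) {lam δ : ℝ}
    (hlam : 0 ≤ lam) (hgap : Real.exp (δ * n) * Z H lam ≤ Z G lam) :
    δ * n ≤ S.card * Real.log (1 + lam) := by
  refine defect_bound (G := G) (H := H.comap σ) (S := S) (fun u v hu hv => ?_) hlam ?_
  · rw [SimpleGraph.comap_adj]
    exact hagree u v hu hv
  · rwa [Z_comap_equiv]

/-- In particular (`S = univ`): `δ ≤ log (1 + λ)` for every witness on `n ≥ 1` vertices. -/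
theorem delta_le_log {n : ℕ} {G H : SimpleGraph (Fin n)} (hn : 0 < n) {lam δ : ℝ}
    (hlam : 0 ≤ lam) (hgap : Real.exp (δ * n) * Z H lam ≤ Z G lam) :
    δ ≤ Real.log (1 + lam) := by
  have h := defect_bound (G := G) (H := H) (S := Finset.univ)
    (fun u v hu _ => (hu (Finset.mem_univ u)).elim) hlam hgap
  rw [Finset.card_univ, Fintype.card_fin] at h
  have hn' : (0 : ℝ) < n := Nat.cast_pos.2 hn
  nlinarith


/-- **Block form of the defect bound.** If the defect set has `|S| ≤ s·M` (at most `s` vertices in each of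
`M` blocks), blocks have `≥ b` vertices and `M·b ≤ n`, then `δ ≤ s·log(1+λ)/b`. For disjoint unions of CFI
pairs over bases of treewidth `≥ k` (`s = 4`, `b > k`) this forces `δ_k → 0`. -/
theorem delta_le_of_blocks {n : ℕ} {G H : SimpleGraph (Fin n)} {S : Finset (Fin n)}
    (hagree : ∀ u v, u ∉ S → v ∉ S → (G.Adj u v ↔ H.Adj u v)) {lam δ : ℝ} (hlam : 0 ≤ lam)
    (hgap : Real.exp (δ * n) * Z H lam ≤ Z G lam) {s M b : ℕ} (hS : S.card ≤ s * M)
    (hMb : M * b ≤ n) (hb : 0 < b) (hn : 0 < n) : δ ≤ s * Real.log (1 + lam) / b := by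
  have h := defect_bound hagree hlam hgap
  have hlog : 0 ≤ Real.log (1 + lam) := Real.log_nonneg (by linarith)
  have hS' : (S.card : ℝ) ≤ s * M := by exact_mod_cast hS
  have hMb' : (M : ℝ) * b ≤ n := by exact_mod_cast hMb
  have hn' : (0 : ℝ) < n := by exact_mod_cast hn
  have hb' : (0 : ℝ) < b := by exact_mod_cast hb
  have h1 : δ * n ≤ s * M * Real.log (1 + lam) :=
    h.trans (mul_le_mul_of_nonneg_right hS' hlog)
  rw [le_div_iff₀ hb']
  have h2 : δ * b * n ≤ s * Real.log (1 + lam) * n :=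
    calc δ * b * n = δ * n * b := by ring
      _ ≤ s * M * Real.log (1 + lam) * b := mul_le_mul_of_nonneg_right h1 hb'.le
      _ = s * Real.log (1 + lam) * (M * b) := by ring
      _ ≤ s * Real.log (1 + lam) * n := mul_le_mul_of_nonneg_left hMb' (by positivity)
  exact le_of_mul_le_mul_right h2 hn'

/-! ### The crux, its pieces, and variants -/

/-- The tree-uniqueness threshold `λ_c(Δ) = (Δ-1)^{Δ-1}/(Δ-2)^Δ` exactly as typed in the crux
(natural-number subtraction in the exponent; junk values `1, -1, 0` at `Δ = 0, 1, 2`). -/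
noncomputable def lamC (Δ : ℕ) : ℝ := ((Δ : ℝ) - 1) ^ (Δ - 1) / ((Δ : ℝ) - 2) ^ Δ

theorem lamC_three : lamC 3 = 4 := by norm_num [lamC]
theorem lamC_zero : lamC 0 = 1 := by norm_num [lamC]

theorem lamC_pos {Δ : ℕ} (hΔ : 3 ≤ Δ) : 0 < lamC Δ := by
  unfold lamC
  have h3 : (3 : ℝ) ≤ Δ := by exact_mod_cast hΔ
  apply div_pos <;> apply pow_pos <;> linarith

/-- Homomorphism indistinguishability over treewidth `< k`, as typed in the crux. -/
def HomIndist (k : ℕ) {n : ℕ} (G H : SimpleGraph (Fin n)) : Prop :=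
  ∀ (m : ℕ) (F : SimpleGraph (Fin m)), Literature.Combinatorics.SimpleGraph.treewidth F < k →
    Nat.card (F →g G) = Nat.card (F →g H)

/-- A witness of the crux at `(Δ, λ, δ, k)`: twins on `n ≥ 1` vertices. -/
def Witness (Δ : ℕ) (lam δ : ℝ) (k n : ℕ) (G H : SimpleGraph (Fin n)) : Prop :=
  0 < n ∧ G.maxDegree ≤ Δ ∧ H.maxDegree ≤ Δ ∧ HomIndist k G H ∧
    Real.exp (δ * n) * Z H lam ≤ Z G lam

/-- The crux, restated through `lamC`, `Witness` (definitionally). -/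
theorem crux_iff : Summit.PneNP.PneNP.Theses.PhaseTwins.MacroscopicTwinsAbove ↔
    ∀ Δ : ℕ, 3 ≤ Δ → ∀ lam : ℝ, lamC Δ < lam → ∃ δ : ℝ, 0 < δ ∧ ∀ k : ℕ,
      ∃ (n : ℕ) (G H : SimpleGraph (Fin n)), Witness Δ lam δ k n G H :=
  Iff.rfl

/-! ### (a) Load-bearing hypotheses -/

/-- The crux WITHOUT `0 < n`. -/
def WithoutPosN : Prop :=
  ∀ Δ : ℕ, 3 ≤ Δ → ∀ lam : ℝ, lamC Δ < lam → ∃ δ : ℝ, 0 < δ ∧ ∀ k : ℕ,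
    ∃ (n : ℕ) (G H : SimpleGraph (Fin n)), G.maxDegree ≤ Δ ∧ H.maxDegree ≤ Δ ∧ HomIndist k G H ∧
      Real.exp (δ * n) * Z H lam ≤ Z G lam

/-- Without `0 < n` the crux is TRIVIALLY TRUE (witness `n = 0`): `0 < n` is what excludes junk. -/
theorem withoutPosN_trivial : WithoutPosN := by
  intro Δ _ lam _
  refine ⟨1, one_pos, fun k => ⟨0, ⊥, ⊥, ?_, ?_, fun m F _ => rfl, ?_⟩⟩
  · simp [SimpleGraph.maxDegree, Finset.univ_eq_empty]
  · simp [SimpleGraph.maxDegree, Finset.univ_eq_empty]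
  · simp

/-- [cycle 2] WITHOUT `0 < δ` the crux is TRIVIALLY TRUE as well (witness `δ = 0`, `G = H = ⊥` on one vertex). -/
theorem withoutPosDelta_trivial :
    ∀ Δ : ℕ, 3 ≤ Δ → ∀ lam : ℝ, lamC Δ < lam → ∃ δ : ℝ, 0 ≤ δ ∧ ∀ k : ℕ,
      ∃ (n : ℕ) (G H : SimpleGraph (Fin n)), Witness Δ lam δ k n G H := by
  intro Δ _ lam _
  refine ⟨0, le_rfl, fun k => ⟨1, ⊥, ⊥, one_pos, ?_, ?_, fun m F _ => rfl, ?_⟩⟩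
  · simp [SimpleGraph.maxDegree]
  · simp [SimpleGraph.maxDegree]
  · simp

/-- [cycle 2] `Z_⊥(λ) = (1+λ)^n`. -/
theorem Z_bot (n : ℕ) (lam : ℝ) : Z (⊥ : SimpleGraph (Fin n)) lam = (1 + lam) ^ n := by
  unfold Z
  have h1 : ∀ I : Finset (Fin n), (⊥ : SimpleGraph (Fin n)).IsIndepSet (↑I : Set (Fin n)) := fun I => by
    intro u _ v _ _ h
    exact h
  simp only [h1, if_true]
  have := Fintype.sum_pow_mul_eq_add_pow (Fin n) lam 1
  simp only [one_pow, mul_one, Fintype.card_fin] at this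
  rw [this, add_comm]

/-- [cycle 2] `Z_{K₂}(λ) = 1 + 2λ`. -/
theorem Z_top_two (lam : ℝ) : Z (⊤ : SimpleGraph (Fin 2)) lam = 1 + 2 * lam := by
  unfold Z
  have huniv : (Finset.univ : Finset (Finset (Fin 2))) = {∅, {0}, {1}, {0, 1}} := by decide
  rw [huniv]
  have hind0 : (⊤ : SimpleGraph (Fin 2)).IsIndepSet (↑(∅ : Finset (Fin 2)) : Set (Fin 2)) := by
    simp [SimpleGraph.isIndepSet_iff]
  have hind1 : ∀ a : Fin 2, (⊤ : SimpleGraph (Fin 2)).IsIndepSet (↑({a} : Finset (Fin 2)) : Set (Fin 2)) := by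
    intro a
    simp [SimpleGraph.isIndepSet_iff]
  have hind2 : ¬ (⊤ : SimpleGraph (Fin 2)).IsIndepSet (↑({0, 1} : Finset (Fin 2)) : Set (Fin 2)) := by
    intro h
    have := h (show (0 : Fin 2) ∈ (↑({0, 1} : Finset (Fin 2)) : Set (Fin 2)) by simp)
      (show (1 : Fin 2) ∈ (↑({0, 1} : Finset (Fin 2)) : Set (Fin 2)) by simp) (by decide)
    exact this (by simp [SimpleGraph.top_adj])
  rw [Finset.sum_insert (by decide), Finset.sum_insert (by decide), Finset.sum_insert (by decide),
    Finset.sum_singleton]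
  simp only [hind0, hind1, hind2, if_true, if_false, Finset.card_empty, Finset.card_singleton, pow_zero, pow_one]
  ring

/-- [cycle 2] WITHOUT hom-indistinguishability the crux is TRIVIALLY TRUE, uniformly in `k`, already on two
vertices: `G = ⊥`, `H = K₂`, `δ = ½ log((1+λ)²/(1+2λ)) > 0` for every `λ > 0`. `HomIndist` is the one hypothesis
that makes the crux non-trivial (it is what forces `n > k`, `lt_card_of_witness`). -/
theorem trivial_without_homIndist :
    ∀ Δ : ℕ, 3 ≤ Δ → ∀ lam : ℝ, 0 < lam → ∃ δ : ℝ, 0 < δ ∧ ∀ k : ℕ,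
      ∃ (n : ℕ) (G H : SimpleGraph (Fin n)), 0 < n ∧ G.maxDegree ≤ Δ ∧ H.maxDegree ≤ Δ ∧
        Real.exp (δ * n) * Z H lam ≤ Z G lam := by
  intro Δ hΔ lam hlam
  have hq : 1 < (1 + lam) ^ 2 / (1 + 2 * lam) := by
    rw [one_lt_div (by linarith)]
    nlinarith
  refine ⟨Real.log ((1 + lam) ^ 2 / (1 + 2 * lam)) / 2, div_pos (Real.log_pos hq) two_pos,
    fun _k => ⟨2, ⊥, ⊤, two_pos, ?_, ?_, ?_⟩⟩
  · refine le_trans (@SimpleGraph.maxDegree_le_of_forall_degree_le (Fin 2) ⊥ _ (_) 0 (fun v => ?_))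
      (Nat.zero_le Δ)
    rw [SimpleGraph.degree, Nat.le_zero, Finset.card_eq_zero, ← Finset.subset_empty]
    intro w hw
    rw [SimpleGraph.mem_neighborFinset] at hw
    exact hw.elim
  · -- `K₂` has maximum degree `1 ≤ Δ`
    refine le_trans (@SimpleGraph.maxDegree_le_of_forall_degree_le (Fin 2) ⊤ _ (_) 1 (fun v => ?_))
      (show 1 ≤ Δ by omega)
    rw [SimpleGraph.degree]
    refine (Finset.card_le_card (t := Finset.univ.erase v) ?_).trans ?_
    · intro w hw
      rw [SimpleGraph.mem_neighborFinset, SimpleGraph.top_adj] at hw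
      simp [Ne.symm hw]
    · simp
  · rw [Z_bot, Z_top_two]
    have h2 : Real.log ((1 + lam) ^ 2 / (1 + 2 * lam)) / 2 * ((2 : ℕ) : ℝ) =
        Real.log ((1 + lam) ^ 2 / (1 + 2 * lam)) := by push_cast; ring
    rw [h2, Real.exp_log (by positivity), div_mul_cancel₀ _ (by positivity)]

/-- The crux WITHOUT the degree floor `3 ≤ Δ`. -/
def WithoutDegreeFloor : Prop :=
  ∀ Δ : ℕ, ∀ lam : ℝ, lamC Δ < lam → ∃ δ : ℝ, 0 < δ ∧ ∀ k : ℕ,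
    ∃ (n : ℕ) (G H : SimpleGraph (Fin n)), Witness Δ lam δ k n G H

/-- A graph of maximum degree `0` has every vertex set independent. -/
theorem isIndepSet_of_maxDegree_le_zero {n : ℕ} (K : SimpleGraph (Fin n)) (hK : K.maxDegree ≤ 0)
    (I : Finset (Fin n)) : K.IsIndepSet (↑I : Set (Fin n)) := by
  intro u _ v _ _ hadj
  have h1 : 0 < K.degree u := (K.degree_pos_iff_exists_adj u).2 ⟨v, hadj⟩
  have h2 := K.degree_le_maxDegree u
  omega

/-- Without `3 ≤ Δ` the crux is FALSE: at `Δ = 0` the threshold formula gives the junk value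
`λ_c(0) = 1`, and max-degree-`0` graphs on `n` vertices all have `Z = (1+λ)^n`. -/
theorem false_without_degreeFloor : ¬ WithoutDegreeFloor := by
  intro h
  obtain ⟨δ, hδ, hk⟩ := h 0 2 (by rw [lamC_zero]; norm_num)
  obtain ⟨n, G, H, hn, hG, hH, -, hgap⟩ := hk 0
  have hZ : ∀ K : SimpleGraph (Fin n), K.maxDegree ≤ 0 →
      Z K 2 = ∑ I : Finset (Fin n), (2 : ℝ) ^ I.card := fun K hK =>
    Finset.sum_congr rfl fun I _ => if_pos (isIndepSet_of_maxDegree_le_zero K hK I)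
  rw [hZ G hG, hZ H hH] at hgap
  have hpos : 0 < ∑ I : Finset (Fin n), (2 : ℝ) ^ I.card :=
    Finset.sum_pos (fun I _ => by positivity) Finset.univ_nonempty
  have h1 : Real.exp (δ * n) ≤ 1 := by
    by_contra hc
    have := mul_lt_mul_of_pos_right (not_le.1 hc) hpos
    linarith
  have h2 : 1 < Real.exp (δ * n) := Real.one_lt_exp_iff.2 (mul_pos hδ (Nat.cast_pos.2 hn))
  linarith

/-- The crux WITHOUT the threshold hypothesis (all `λ > 0`). -/
def WithoutThreshold : Prop :=
  ∀ Δ : ℕ, 3 ≤ Δ → ∀ lam : ℝ, 0 < lam → ∃ δ : ℝ, 0 < δ ∧ ∀ k : ℕ,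
    ∃ (n : ℕ) (G H : SimpleGraph (Fin n)), Witness Δ lam δ k n G H

/-- Without `λ > λ_c(Δ)` the crux contradicts the route's own support `DensityContinuityBelow`
(stmt-PneNP-2725, BCKL 2013 Remark 1 + Weitz 2006; known in substance): at `Δ = 3`, `λ = 1 < 4`. -/
theorem false_without_threshold_of_densityContinuityBelow
    (hD : Summit.PneNP.PneNP.Theses.PhaseTwins.DensityContinuityBelow) : ¬ WithoutThreshold := by
  intro h
  obtain ⟨δ, hδ, hk⟩ := h 3 le_rfl 1 one_pos
  obtain ⟨k, hk'⟩ := hD 3 le_rfl 1 zero_le_one (by norm_num) (δ / 2) (by positivity)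
  obtain ⟨n, G, H, hn, hG, hH, hhom, hgap⟩ := hk k
  have h1 : Z G 1 ≤ Real.exp (δ / 2 * n) * Z H 1 := hk' n G H hG hH hhom
  have hZH := Z_pos H zero_le_one
  have h3 : Real.exp (δ * n) ≤ Real.exp (δ / 2 * n) := le_of_mul_le_mul_right (hgap.trans h1) hZH
  rw [Real.exp_le_exp] at h3
  have hn' : (0 : ℝ) < n := Nat.cast_pos.2 hn
  nlinarith

/-! ### (c) Natural strengthenings / weakenings -/

/-- The crux with `∃ δ` and `∀ k` SWAPPED. -/
def SwappedQuantifiers : Prop :=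
  ∀ Δ : ℕ, 3 ≤ Δ → ∀ lam : ℝ, lamC Δ < lam → ∀ k : ℕ, ∃ δ : ℝ, 0 < δ ∧
    ∃ (n : ℕ) (G H : SimpleGraph (Fin n)), Witness Δ lam δ k n G H

/-- The swapped form carries NO density content: it follows at once from the constant-factor
support `ConstantFactorTwinsEverywhere` (stmt-PneNP-2726) with `δ := log 2 / n`. The whole content
of the crux is that `δ` does not depend on `k`. -/
theorem swapped_of_constantFactorTwins
    (h : Summit.PneNP.PneNP.Theses.PhaseTwins.ConstantFactorTwinsEverywhere) :
    SwappedQuantifiers := by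
  intro Δ hΔ lam hlam k
  have hlam0 : 0 < lam := (lamC_pos hΔ).trans hlam
  obtain ⟨n, G, H, hn, hG, hH, hhom, hgap⟩ := h Δ hΔ lam hlam0 k
  have hn' : (0 : ℝ) < n := Nat.cast_pos.2 hn
  refine ⟨Real.log 2 / n, div_pos (Real.log_pos one_lt_two) hn', n, G, H, hn, hG, hH, hhom, ?_⟩
  have : Real.exp (Real.log 2 / n * n) = 2 := by
    rw [div_mul_cancel₀ _ hn'.ne', Real.exp_log two_pos]
  show Real.exp (Real.log 2 / n * n) * Z H lam ≤ Z G lam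
  rw [this]
  exact hgap

/-! ### Witnesses must outgrow `k` (no single pair serves all `k`) -/

open Literature.ModelTheory.FiniteModelTheory in
/-- With at least as many pebble pairs as vertices, Duplicator's winning strategy yields an
isomorphism (pebble every vertex). -/
theorem iso_of_ckEquiv_of_card_le {n k : ℕ} {G H : SimpleGraph (Fin n)} (h : CkEquiv k G H)
    (hnk : n ≤ k) : Nonempty (G ≃g H) := by
  obtain ⟨S⟩ := h
  have key : ∀ t ≤ n, ∃ p ∈ S.carrier, ∃ b : Fin n → Fin n,
      p.ncard ≤ t ∧ ∀ i : Fin n, (i : ℕ) < t → (i, b i) ∈ p := by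
    intro t
    induction t with
    | zero => exact fun _ => ⟨∅, S.empty_mem, id, by simp, fun i hi => (Nat.not_lt_zero _ hi).elim⟩
    | succ t ih =>
      intro ht
      obtain ⟨p, hp, b, hcard, hmem⟩ := ih (Nat.le_of_succ_le ht)
      have htn : t < n := ht
      obtain ⟨f, hf⟩ := S.forth hp (by omega)
      set a : Fin n := ⟨t, htn⟩ with ha
      refine ⟨insert (a, f a) p, hf a, Function.update b a (f a), ?_, fun i hi => ?_⟩
      · exact (Set.ncard_insert_le _ _).trans (by omega)
      · rcases Nat.lt_succ_iff_lt_or_eq.1 hi with hlt | heq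
        · have hia : i ≠ a := fun h => by rw [h] at hlt; exact lt_irrefl _ hlt
          rw [Function.update_of_ne hia]
          exact Set.mem_insert_of_mem _ (hmem i hlt)
        · have hia : i = a := Fin.ext heq
          subst hia
          rw [Function.update_self]
          exact Set.mem_insert _ _
  obtain ⟨p, hp, b, -, hmem⟩ := key n le_rfl
  have hiso := S.isPartialIso_of_mem hp
  have hinj : Function.Injective b := fun i j hij =>
    (hiso.eq_iff (hmem i i.isLt) (hmem j j.isLt)).2 hij
  have hbij : Function.Bijective b := Finite.injective_iff_bijective.1 hinj
  exact ⟨⟨Equiv.ofBijective b hbij, fun {i j} => (hiso.adj_iff (hmem i i.isLt) (hmem j j.isLt)).symm⟩⟩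

open Literature.ModelTheory.FiniteModelTheory in
/-- Hence every witness of the crux at depth `k` has MORE THAN `k` vertices: `n` must grow with
`k` (there is no single pair serving all `k`; the Dvořák bridge is PROVED in the tree). -/
theorem lt_card_of_witness {Δ : ℕ} {lam δ : ℝ} {k n : ℕ} {G H : SimpleGraph (Fin n)}
    (hδ : 0 < δ) (hlam : 0 ≤ lam) (hw : Witness Δ lam δ k n G H) : k < n := by
  by_contra hkn
  have hkn : n ≤ k := not_lt.1 hkn
  obtain ⟨hn, -, -, hhom, hgap⟩ := hw
  have hk1 : 1 ≤ k := hn.trans_le hkn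
  have hck : CkEquiv k G H :=
    (Dvorak2010_ckEquiv_iff_homCount_holds.homCount_iff_ckEquiv k hk1 n n G H).1 hhom
  obtain ⟨e⟩ := iso_of_ckEquiv_of_card_le hck hkn
  rw [Z_eq_of_iso e lam] at hgap
  have hZH := Z_pos H hlam
  have h1 : Real.exp (δ * n) ≤ 1 := by
    by_contra hc
    have := mul_lt_mul_of_pos_right (not_le.1 hc) hZH
    linarith
  have h2 : 1 < Real.exp (δ * n) := Real.one_lt_exp_iff.2 (mul_pos hδ (Nat.cast_pos.2 hn))
  linarith

/-- The strengthening "one pair of twins serves every depth `k`" is FALSE. -/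
theorem not_singlePair : ¬ ∃ (Δ : ℕ) (lam δ : ℝ) (n : ℕ) (G H : SimpleGraph (Fin n)),
    0 ≤ lam ∧ 0 < δ ∧ ∀ k, Witness Δ lam δ k n G H := by
  rintro ⟨Δ, lam, δ, n, G, H, hlam, hδ, hw⟩
  exact lt_irrefl n (lt_card_of_witness hδ hlam (hw n))



/-! ### The exact shape of a refutation: density continuity at ONE point above `λ_c` -/

/-- Density continuity of the hard-core free energy at `(Δ, λ)` with respect to the `C^k`-type — literally the
conclusion shape of the support `DensityContinuityBelow` (stmt-PneNP-2725), at a single activity. -/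
def DensityContinuityAt (Δ : ℕ) (lam : ℝ) : Prop :=
  ∀ δ : ℝ, 0 < δ → ∃ k : ℕ, ∀ (n : ℕ) (G H : SimpleGraph (Fin n)), G.maxDegree ≤ Δ → H.maxDegree ≤ Δ →
    HomIndist k G H → Z G lam ≤ Real.exp (δ * n) * Z H lam

/-- On `Fin 0` every hard-core sum is `1` (only `I = ∅`). -/
theorem Z_fin_zero (G : SimpleGraph (Fin 0)) (lam : ℝ) : Z G lam = 1 := by
  unfold Z
  rw [Fintype.sum_eq_single (∅ : Finset (Fin 0)) (fun I hI => (hI (Finset.eq_empty_of_isEmpty I)).elim)]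
  simp [SimpleGraph.isIndepSet_iff, Set.Pairwise]

/-- **Shape of a refutation.** `¬ MacroscopicTwinsAbove` is EQUIVALENT to density continuity at some single point
`(Δ ≥ 3, λ > λ_c(Δ))`: a kill is exactly an extension of `DensityContinuityBelow` to one activity above the
uniqueness threshold (a "second threshold" theorem), nothing less. -/
theorem not_crux_iff_densityContinuityAt :
    ¬ Summit.PneNP.PneNP.Theses.PhaseTwins.MacroscopicTwinsAbove ↔
      ∃ Δ : ℕ, 3 ≤ Δ ∧ ∃ lam : ℝ, lamC Δ < lam ∧ DensityContinuityAt Δ lam := by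
  rw [crux_iff]
  constructor
  · intro h
    by_contra hc
    apply h
    intro Δ hΔ lam hlam
    by_contra hδ
    apply hc
    refine ⟨Δ, hΔ, lam, hlam, fun δ hδpos => ?_⟩
    have hlam0 : 0 ≤ lam := ((lamC_pos hΔ).trans hlam).le
    -- no `δ` works for the crux at `(Δ, λ)`; in particular not this one
    have hk : ∃ k : ℕ, ∀ (n : ℕ) (G H : SimpleGraph (Fin n)), ¬ Witness Δ lam δ k n G H := by
      by_contra hk
      apply hδ
      refine ⟨δ, hδpos, fun k => ?_⟩
      by_contra hw
      apply hk
      refine ⟨k, fun n G H hW => hw ⟨n, G, H, hW⟩⟩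
    obtain ⟨k, hk⟩ := hk
    refine ⟨k, fun n G H hG hH hhom => ?_⟩
    rcases Nat.eq_zero_or_pos n with rfl | hn
    · rw [Z_fin_zero, Z_fin_zero]
      simp
    · have hw := hk n G H
      unfold Witness at hw
      have : ¬ Real.exp (δ * n) * Z H lam ≤ Z G lam := fun hle => hw ⟨hn, hG, hH, hhom, hle⟩
      exact (not_le.1 this).le
  · rintro ⟨Δ, hΔ, lam, hlam, hcont⟩ h
    obtain ⟨δ, hδ, hk⟩ := h Δ hΔ lam hlam
    obtain ⟨k, hk'⟩ := hcont (δ / 2) (by positivity)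
    obtain ⟨n, G, H, hn, hG, hH, hhom, hgap⟩ := hk k
    have hlam0 : 0 ≤ lam := ((lamC_pos hΔ).trans hlam).le
    have h1 := hk' n G H hG hH hhom
    have hZH := Z_pos H hlam0
    have h3 : Real.exp (δ * n) ≤ Real.exp (δ / 2 * n) :=
      le_of_mul_le_mul_right (hgap.trans h1) hZH
    rw [Real.exp_le_exp] at h3
    have hn' : (0 : ℝ) < n := Nat.cast_pos.2 hn
    nlinarith

/-- In particular the route's support `DensityContinuityBelow` (all `λ < λ_c`) and the crux (all `λ > λ_c`) are
the two halves of a DICHOTOMY exactly at `λ_c(Δ)`; the crux leaves the point `λ = λ_c(Δ)` itself unclaimed. -/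
theorem densityContinuityAt_of_below (hD : Summit.PneNP.PneNP.Theses.PhaseTwins.DensityContinuityBelow)
    {Δ : ℕ} (hΔ : 3 ≤ Δ) {lam : ℝ} (h0 : 0 ≤ lam) (hlt : lam < lamC Δ) : DensityContinuityAt Δ lam :=
  fun δ hδ => hD Δ hΔ lam h0 hlt δ hδ

/-! ### (b′) [cycle 2] Twins cannot be sparse: `δ n ≤ 2(e_G + e_H) log(1+λ)` -/

/-- At most `2e` vertices have positive degree (`Σ_v deg v = 2e`). -/
theorem card_posDegree_le_twice_edges {n : ℕ} (G : SimpleGraph (Fin n)) :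
    (Finset.univ.filter fun v : Fin n => 0 < G.degree v).card ≤ 2 * G.edgeFinset.card := by
  rw [← SimpleGraph.sum_degrees_eq_twice_card_edges]
  calc (Finset.univ.filter fun v : Fin n => 0 < G.degree v).card
      = ∑ v ∈ Finset.univ.filter (fun v : Fin n => 0 < G.degree v), 1 := by simp
    _ ≤ ∑ v ∈ Finset.univ.filter (fun v : Fin n => 0 < G.degree v), G.degree v :=
        Finset.sum_le_sum fun v hv => (Finset.mem_filter.1 hv).2
    _ ≤ ∑ v, G.degree v :=
        Finset.sum_le_sum_of_subset_of_nonneg (Finset.filter_subset _ _) fun _ _ _ => Nat.zero_le _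

/-- **Edge form of the defect bound.** Twins with gap `e^{δn}` agree off the set of non-isolated vertices, so
`δ · n ≤ 2 (|E(G)| + |E(H)|) · log(1+λ)`: a witness family needs linearly many edges (average degree
`≥ δ / (2 log(1+λ))` summed over the pair); sparse twins are impossible. -/
theorem defect_bound_edges {n : ℕ} {G H : SimpleGraph (Fin n)} {lam δ : ℝ} (hlam : 0 ≤ lam)
    (hgap : Real.exp (δ * n) * Z H lam ≤ Z G lam) :
    δ * n ≤ 2 * ((G.edgeFinset.card : ℝ) + H.edgeFinset.card) * Real.log (1 + lam) := by
  set S : Finset (Fin n) := Finset.univ.filter (fun v : Fin n => 0 < G.degree v ∨ 0 < H.degree v) with hS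
  have hagree : ∀ u v, u ∉ S → v ∉ S → (G.Adj u v ↔ H.Adj u v) := by
    intro u v hu _
    have hu' : G.degree u = 0 ∧ H.degree u = 0 := by
      simp only [hS, Finset.mem_filter, Finset.mem_univ, true_and, not_or, not_lt, Nat.le_zero] at hu
      exact hu
    constructor
    · intro h
      have := (G.degree_pos_iff_exists_adj u).2 ⟨v, h⟩
      omega
    · intro h
      have := (H.degree_pos_iff_exists_adj u).2 ⟨v, h⟩
      omega
  have h1 := defect_bound hagree hlam hgap
  have hScard : S.card ≤ 2 * G.edgeFinset.card + 2 * H.edgeFinset.card := by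
    have hsplit : S = (Finset.univ.filter fun v : Fin n => 0 < G.degree v) ∪
        (Finset.univ.filter fun v : Fin n => 0 < H.degree v) := by
      rw [hS, ← Finset.filter_or]
    rw [hsplit]
    exact (Finset.card_union_le _ _).trans
      (Nat.add_le_add (card_posDegree_le_twice_edges G) (card_posDegree_le_twice_edges H))
  have hlog : 0 ≤ Real.log (1 + lam) := Real.log_nonneg (by linarith)
  have hScard' : (S.card : ℝ) ≤ 2 * ((G.edgeFinset.card : ℝ) + H.edgeFinset.card) := by
    have : ((S.card : ℕ) : ℝ) ≤ ((2 * G.edgeFinset.card + 2 * H.edgeFinset.card : ℕ) : ℝ) := by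
      exact_mod_cast hScard
    push_cast at this
    linarith
  calc δ * n ≤ S.card * Real.log (1 + lam) := h1
    _ ≤ 2 * ((G.edgeFinset.card : ℝ) + H.edgeFinset.card) * Real.log (1 + lam) :=
        mul_le_mul_of_nonneg_right hScard' hlog

/-! ### (c′) [cycle 2] The threshold decays like `1/Δ`; no uniform `δ` -/

/-- `e² < 8`. -/
theorem exp_two_lt_eight : Real.exp 2 < 8 := by
  have h1 := Real.exp_one_lt_d9
  have h : Real.exp 2 = Real.exp 1 ^ 2 := by
    rw [← Real.exp_nat_mul]; norm_num
  rw [h]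
  nlinarith [Real.exp_pos 1]

/-- `(1 + 1/d)^{d+1} ≤ 8` for `d ≥ 1` (via `1 + x ≤ eˣ` and `e² < 8`). -/
theorem one_add_inv_pow_le {d : ℕ} (hd : 1 ≤ d) : (1 + 1 / (d : ℝ)) ^ (d + 1) ≤ 8 := by
  have hd0 : (0 : ℝ) < d := by exact_mod_cast (show 0 < d by omega)
  have h3 : (1 + 1 / (d : ℝ)) ≤ Real.exp (1 / d) := by
    have := Real.add_one_le_exp (1 / (d : ℝ)); linarith
  have h4 : (1 + 1 / (d : ℝ)) ^ (d + 1) ≤ Real.exp (1 / d) ^ (d + 1) :=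
    pow_le_pow_left₀ (by positivity) h3 _
  have h5 : Real.exp (1 / (d : ℝ)) ^ (d + 1) = Real.exp (((d + 1 : ℕ) : ℝ) * (1 / d)) := by
    rw [← Real.exp_nat_mul]
  have h6 : ((d + 1 : ℕ) : ℝ) * (1 / d) ≤ 2 := by
    have hd1 : (1 : ℝ) ≤ d := by exact_mod_cast hd
    rw [mul_one_div, div_le_iff₀ hd0]
    push_cast
    linarith
  calc (1 + 1 / (d : ℝ)) ^ (d + 1) ≤ Real.exp (1 / d) ^ (d + 1) := h4
    _ = Real.exp (((d + 1 : ℕ) : ℝ) * (1 / d)) := h5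
    _ ≤ Real.exp 2 := Real.exp_le_exp.2 h6
    _ ≤ 8 := exp_two_lt_eight.le

/-- **The typed threshold decays like `1/Δ`:** `λ_c(Δ) ≤ 8/(Δ-2)` for `Δ ≥ 3`. -/
theorem lamC_le_div {Δ : ℕ} (hΔ : 3 ≤ Δ) : lamC Δ ≤ 8 / ((Δ : ℝ) - 2) := by
  obtain ⟨d, rfl⟩ : ∃ d, Δ = d + 2 := ⟨Δ - 2, by omega⟩
  have hd : 1 ≤ d := by omega
  have hd0 : (0 : ℝ) < d := by exact_mod_cast (show 0 < d by omega)
  unfold lamC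
  have e1 : ((d + 2 : ℕ) : ℝ) - 1 = d + 1 := by push_cast; ring
  have e2 : ((d + 2 : ℕ) : ℝ) - 2 = d := by push_cast; ring
  have e3 : d + 2 - 1 = d + 1 := by omega
  rw [e1, e2, e3]
  have key : ((d : ℝ) + 1) ^ (d + 1) ≤ 8 * (d : ℝ) ^ (d + 1) := by
    have h1 : (d : ℝ) + 1 = d * (1 + 1 / d) := by field_simp
    calc ((d : ℝ) + 1) ^ (d + 1) = (d : ℝ) ^ (d + 1) * (1 + 1 / d) ^ (d + 1) := by
          rw [h1, mul_pow]
      _ ≤ (d : ℝ) ^ (d + 1) * 8 := by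
          gcongr
          exact one_add_inv_pow_le hd
      _ = 8 * (d : ℝ) ^ (d + 1) := by ring
  rw [div_le_div_iff₀ (by positivity) hd0]
  calc ((d : ℝ) + 1) ^ (d + 1) * d ≤ 8 * (d : ℝ) ^ (d + 1) * d := by gcongr
    _ = 8 * (d : ℝ) ^ (d + 2) := by ring

/-- The crux with ONE `δ` serving every `Δ ≥ 3` and every `λ > λ_c(Δ)` (a uniform density gap). -/
def UniformDelta : Prop :=
  ∃ δ : ℝ, 0 < δ ∧ ∀ Δ : ℕ, 3 ≤ Δ → ∀ lam : ℝ, lamC Δ < lam → ∀ k : ℕ,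
    ∃ (n : ℕ) (G H : SimpleGraph (Fin n)), Witness Δ lam δ k n G H

/-- **No uniform density gap**: `UniformDelta` is FALSE — `δ ≤ log(1 + λ) ≤ λ` for every witness (`delta_le_log`)
while `λ_c(Δ) ≤ 8/(Δ-2) → 0`; take `Δ = d + 2` with `d > 9/δ` and `λ = 9/d`. The crux's `δ` must depend on `(Δ, λ)`
and degenerate in the large-degree / small-activity corner. -/
theorem not_uniformDelta : ¬ UniformDelta := by
  rintro ⟨δ, hδ, h⟩
  obtain ⟨d, hd⟩ : ∃ d : ℕ, 9 / δ < d := exists_nat_gt _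
  have hdpos : (0 : ℝ) < d := lt_trans (by positivity) hd
  have hΔ : 3 ≤ d + 2 := by
    have : 0 < d := by exact_mod_cast hdpos
    omega
  have hcast : ((d + 2 : ℕ) : ℝ) - 2 = d := by push_cast; ring
  have hlamC : lamC (d + 2) < 9 / d := by
    calc lamC (d + 2) ≤ 8 / (((d + 2 : ℕ) : ℝ) - 2) := lamC_le_div hΔ
      _ = 8 / d := by rw [hcast]
      _ < 9 / d := by gcongr; norm_num
  obtain ⟨n, G, H, hn, -, -, -, hgap⟩ := h (d + 2) hΔ (9 / d) hlamC 0
  have hlam : (0 : ℝ) ≤ 9 / d := by positivity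
  have h1 : δ ≤ Real.log (1 + 9 / d) := delta_le_log hn hlam hgap
  have h2 : Real.log (1 + 9 / d) ≤ 9 / d := by
    have := Real.log_le_sub_one_of_pos (show (0 : ℝ) < 1 + 9 / d by positivity)
    linarith
  have h3 : 9 / (d : ℝ) < δ := by
    rw [div_lt_iff₀ hdpos]
    rw [div_lt_iff₀ hδ] at hd
    linarith
  linarith

/-! ### (a′) [cycle 2] The second degree bound is implied at depth `k ≥ 2` (star homomorphism counts) -/

section Star

open Literature.Combinatorics.SimpleGraph

/-- The star `K_{1,j}` on `Fin (j+1)` with centre `0`. -/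
def star (j : ℕ) : SimpleGraph (Fin (j + 1)) :=
  SimpleGraph.fromRel fun a _ => a = 0

theorem star_adj {j : ℕ} (a b : Fin (j + 1)) : (star j).Adj a b ↔ a ≠ b ∧ (a = 0 ∨ b = 0) := by
  simp [star, SimpleGraph.fromRel_adj]

theorem star_adj_zero_succ {j : ℕ} (i : Fin j) : (star j).Adj 0 i.succ := by
  rw [star_adj]
  exact ⟨(Fin.succ_ne_zero i).symm, Or.inl rfl⟩

/-- Stars have treewidth `≤ 1` (bags `{0, t}` along a path; `treewidth_le_of_intervals`). -/
theorem treewidth_star_le (j : ℕ) : treewidth (star j) ≤ 1 := by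
  refine treewidth_le_of_intervals (star j)
    (fun t : Fin (j + 1) => ({0, t} : Finset (Fin (j + 1)))) ?_ ?_ ?_ ?_
  · intro u v huv
    rw [star_adj] at huv
    rcases huv.2 with h | h
    · exact ⟨v, by simp [h]⟩
    · exact ⟨u, by simp [h]⟩
  · intro v
    exact ⟨v, by simp⟩
  · intro v
    by_cases hv : v = 0
    · subst hv
      have : {t : Fin (j + 1) | (0 : Fin (j + 1)) ∈ ({0, t} : Finset (Fin (j + 1)))} = Set.univ := by
        ext t; simp
      rw [this]
      exact Set.ordConnected_univ
    · have : {t : Fin (j + 1) | v ∈ ({0, t} : Finset (Fin (j + 1)))} = {v} := by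
        ext t
        simp only [Finset.mem_insert, Finset.mem_singleton, Set.mem_setOf_eq, Set.mem_singleton_iff, hv,
          false_or]
        exact eq_comm
      rw [this]
      exact Set.ordConnected_singleton
  · intro t
    exact (Finset.card_insert_le _ _).trans (by simp)

/-- Lower bound on star counts: a vertex of degree `d` gives `d^j` homomorphisms `K_{1,j} → H`. -/
theorem pow_degree_le_card_hom_star {n : ℕ} (j : ℕ) (H : SimpleGraph (Fin n)) (w : Fin n) :
    H.degree w ^ j ≤ Nat.card (star j →g H) := by
  haveI : Finite (star j →g H) :=
    Finite.of_injective (fun φ : star j →g H => (φ : Fin (j + 1) → Fin n)) DFunLike.coe_injective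
  let φ : (Fin j → H.neighborSet w) → (star j →g H) := fun f =>
    { toFun := fun a => if h : a = 0 then w else (f (a.pred h)).1
      map_rel' := by
        intro a b hab
        rw [star_adj] at hab
        obtain ⟨hne, h0 | h0⟩ := hab
        · subst h0
          have hb : b ≠ 0 := fun hb => hne hb.symm
          simp only [dif_pos, dif_neg hb]
          exact (f (b.pred hb)).2
        · subst h0
          simp only [dif_pos, dif_neg hne]
          exact ((f (a.pred hne)).2).symm }
  have hinj : Function.Injective φ := by
    intro f g hfg
    funext i
    have h := congrArg (fun ψ : star j →g H => ψ i.succ) hfg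
    simp only [φ, RelHom.coeFn_mk, dif_neg (Fin.succ_ne_zero i), Fin.pred_succ] at h
    exact Subtype.ext h
  have h1 := Nat.card_le_card_of_injective φ hinj
  have h2 : Nat.card (Fin j → H.neighborSet w) = H.degree w ^ j := by
    rw [Nat.card_fun, Nat.card_eq_fintype_card, Nat.card_eq_fintype_card, Fintype.card_fin,
      SimpleGraph.card_neighborSet_eq_degree]
  rw [h2] at h1
  exact h1

/-- Upper bound on star counts: with maximum degree `≤ Δ` there are at most `n·Δ^j` homomorphisms `K_{1,j} → G`. -/
theorem card_hom_star_le {n : ℕ} (j : ℕ) (G : SimpleGraph (Fin n)) {Δ : ℕ} (hG : G.maxDegree ≤ Δ) :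
    Nat.card (star j →g G) ≤ n * Δ ^ j := by
  let ψ : (star j →g G) → Σ v : Fin n, (Fin j → G.neighborSet v) := fun φ =>
    ⟨φ 0, fun i => ⟨φ i.succ, φ.map_rel (star_adj_zero_succ i)⟩⟩
  have hinj : Function.Injective ψ := by
    intro φ₁ φ₂ h
    simp only [ψ, Sigma.mk.injEq] at h
    obtain ⟨h0, hs⟩ := h
    apply RelHom.ext
    intro a
    refine Fin.cases ?_ (fun i => ?_) a
    · exact h0
    · have key : ∀ (v₁ v₂ : Fin n) (_ : v₁ = v₂) (f₁ : Fin j → G.neighborSet v₁)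
          (f₂ : Fin j → G.neighborSet v₂), HEq f₁ f₂ → ∀ i, (f₁ i).1 = (f₂ i).1 := by
        intro v₁ v₂ hv f₁ f₂ hf i
        subst hv
        rw [heq_iff_eq] at hf
        rw [hf]
      exact key _ _ h0 _ _ hs i
  have h1 := Nat.card_le_card_of_injective ψ hinj
  have h2 : Nat.card (Σ v : Fin n, (Fin j → G.neighborSet v)) = ∑ v : Fin n, G.degree v ^ j := by
    rw [Nat.card_eq_fintype_card, Fintype.card_sigma]
    refine Finset.sum_congr rfl fun v _ => ?_
    rw [Fintype.card_fun, Fintype.card_fin, SimpleGraph.card_neighborSet_eq_degree]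
  rw [h2] at h1
  refine h1.trans ?_
  calc ∑ v : Fin n, G.degree v ^ j ≤ ∑ _v : Fin n, Δ ^ j :=
        Finset.sum_le_sum fun v _ => Nat.pow_le_pow_left ((G.degree_le_maxDegree v).trans hG) j
    _ = n * Δ ^ j := by simp

/-- Bernoulli in `ℕ`: `Δ^{j+1} + (j+1)·Δ^j ≤ (Δ+1)^{j+1}`. -/
theorem bernoulli_nat (Δ j : ℕ) : Δ ^ (j + 1) + (j + 1) * Δ ^ j ≤ (Δ + 1) ^ (j + 1) := by
  induction j with
  | zero => simp
  | succ j ih =>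
    have h1 : (Δ + 1) ^ (j + 2) = (Δ + 1) ^ (j + 1) * (Δ + 1) := pow_succ _ _
    have h2 : (Δ ^ (j + 1) + (j + 1) * Δ ^ j) * (Δ + 1) ≤ (Δ + 1) ^ (j + 1) * (Δ + 1) :=
      Nat.mul_le_mul_right _ ih
    have h3 : Δ ^ (j + 2) + (j + 2) * Δ ^ (j + 1) ≤ (Δ ^ (j + 1) + (j + 1) * Δ ^ j) * (Δ + 1) := by
      have : Δ ^ (j + 2) = Δ ^ (j + 1) * Δ := pow_succ _ _
      have : Δ ^ (j + 1) = Δ ^ j * Δ := pow_succ _ _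
      nlinarith [Nat.zero_le (Δ ^ j), Nat.zero_le (j * Δ ^ j)]
    calc Δ ^ (j + 2) + (j + 2) * Δ ^ (j + 1) ≤ (Δ ^ (j + 1) + (j + 1) * Δ ^ j) * (Δ + 1) := h3
      _ ≤ (Δ + 1) ^ (j + 1) * (Δ + 1) := h2
      _ = (Δ + 1) ^ (j + 2) := h1.symm

/-- The numeric fact behind the star argument: `n·Δ^{nΔ+1} < (Δ+1)^{nΔ+1}`. -/
theorem numeric_star (n Δ : ℕ) : n * Δ ^ (n * Δ + 1) < (Δ + 1) ^ (n * Δ + 1) := by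
  have h := bernoulli_nat Δ (n * Δ)
  have hpos : 1 ≤ Δ ^ (n * Δ) := by
    rcases Nat.eq_zero_or_pos Δ with rfl | hΔ
    · simp
    · exact Nat.one_le_pow _ _ hΔ
  have h2 : (n * Δ + 1) * Δ ^ (n * Δ) = n * Δ ^ (n * Δ + 1) + Δ ^ (n * Δ) := by ring
  omega

/-- **The second degree bound is implied.** If `G ≡ H` over treewidth `< k` with `k ≥ 2` and `G.maxDegree ≤ Δ`,
then `H.maxDegree ≤ Δ` (a vertex of `H` of degree `≥ Δ+1` would give `(Δ+1)^j ≤ hom(K_{1,j},H) = hom(K_{1,j},G)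
≤ n Δ^j`, impossible at `j = nΔ+1`). -/
theorem maxDegree_le_of_homIndist {n k Δ : ℕ} {G H : SimpleGraph (Fin n)} (hk : 2 ≤ k)
    (hhom : HomIndist k G H) (hG : G.maxDegree ≤ Δ) : H.maxDegree ≤ Δ := by
  by_contra hH
  have hH' : Δ < H.maxDegree := not_le.1 hH
  rcases Nat.eq_zero_or_pos n with rfl | hn
  · have : H.maxDegree = 0 := by
      simp [SimpleGraph.maxDegree, Finset.univ_eq_empty]
    omega
  · haveI : Nonempty (Fin n) := ⟨⟨0, hn⟩⟩
    obtain ⟨w, hw⟩ := H.exists_maximal_degree_vertex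
    have h1 : (Δ + 1) ^ (n * Δ + 1) ≤ Nat.card (star (n * Δ + 1) →g H) :=
      (Nat.pow_le_pow_left (by omega) _).trans (pow_degree_le_card_hom_star (n * Δ + 1) H w)
    have h2 : Nat.card (star (n * Δ + 1) →g G) ≤ n * Δ ^ (n * Δ + 1) :=
      card_hom_star_le (n * Δ + 1) G hG
    have h3 : Nat.card (star (n * Δ + 1) →g G) = Nat.card (star (n * Δ + 1) →g H) :=
      hhom _ (star (n * Δ + 1)) (lt_of_le_of_lt (treewidth_star_le _) (lt_of_lt_of_le one_lt_two hk))
    have h4 := numeric_star n Δ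
    omega

end Star

/-- The crux WITHOUT the hypothesis `H.maxDegree ≤ Δ` (only `G`'s degree is bounded). -/
def WithoutDegH : Prop :=
  ∀ Δ : ℕ, 3 ≤ Δ → ∀ lam : ℝ, lamC Δ < lam → ∃ δ : ℝ, 0 < δ ∧ ∀ k : ℕ,
    ∃ (n : ℕ) (G H : SimpleGraph (Fin n)), 0 < n ∧ G.maxDegree ≤ Δ ∧ HomIndist k G H ∧
      Real.exp (δ * n) * Z H lam ≤ Z G lam

/-- **`H.maxDegree ≤ Δ` is redundant**: the crux is EQUIVALENT to `WithoutDegH` (use depth `max k 2` and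
`maxDegree_le_of_homIndist`; `HomIndist` is antitone in the depth). NOT a load-bearing hypothesis. -/
theorem crux_iff_withoutDegH :
    Summit.PneNP.PneNP.Theses.PhaseTwins.MacroscopicTwinsAbove ↔ WithoutDegH := by
  rw [crux_iff]
  constructor
  · intro h Δ hΔ lam hlam
    obtain ⟨δ, hδ, hk⟩ := h Δ hΔ lam hlam
    refine ⟨δ, hδ, fun k => ?_⟩
    obtain ⟨n, G, H, hn, hG, -, hhom, hgap⟩ := hk k
    exact ⟨n, G, H, hn, hG, hhom, hgap⟩
  · intro h Δ hΔ lam hlam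
    obtain ⟨δ, hδ, hk⟩ := h Δ hΔ lam hlam
    refine ⟨δ, hδ, fun k => ?_⟩
    obtain ⟨n, G, H, hn, hG, hhom, hgap⟩ := hk (max k 2)
    have hhom' : HomIndist k G H := fun m F hF => hhom m F (lt_of_lt_of_le hF (le_max_left _ _))
    exact ⟨n, G, H, hn, hG, maxDegree_le_of_homIndist (le_max_right k 2) hhom hG, hhom', hgap⟩

/-! ### (d) [cycle 3] Targets: the seven stubs of the PICKED line `literal-gadgets-cfi-apparatus`

The lead picked `Lines/literal-gadgets-cfi-apparatus.lean` (PICKED.md): `MacroscopicTwinsAbove_of` derives the crux BY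
NAME from `stub_slyGadgets` (S1, trust base = Sly 2010 Thm 2.1 derandomised), `stub_farSystems` (S2),
`stub_duplicator` (S3), `stub_maxDegree` (S4), `stub_connector` (S5), `stub_energy` (S6), `stub_parameters` (S7).
Cheap attacks on every stub SIGNATURE (degenerate parameters, dropped hypotheses, small models — job j011053,
exact rational arithmetic; paper re-derivations in the module docblock §(d)): NONE breaks. What the attacks do
show is which hypotheses of the stubs are load-bearing; the one such fact that is pure algebra is formalised here:
the SECTOR hypothesis `K·D·log ρ_F ≤ κ₁·log B` of S6(ii) cannot be dropped (`not_sectorOptWithoutCoupling`: with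
`κ₁ = 0` the all-`−` phase vector outweighs the reference vector already for one equation, by strict
monotonicity of the complex factor in the vacancy probabilities, `cxWeight_strictMono`; the landed version
Negative/SectorCoupling.lean p80502 adds `sectorOpt_false_without_coupling_any`: the same for EVERY system with at
least one equation). -/

section Targets

open Summit.PneNP.PneNP.Cruxes.PolyDepthTwinsAbove.ParityWiredPorts (occP occM pairW CxVert cxGraph cxWeight
  cxW pwPsi cxRho)
open Literature.Computability.Complexity (slyB)
-- `lgW`, `lgRef` are the LANDED definitions of the line (`PhaseTwinsMacroscopicTwinsAboveDefs`), not copies.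
open Summit.PneNP.PneNP.Cruxes.MacroscopicTwinsAbove.LiteralGadgetsCfiApparatus (lgW lgRef)

/-- Monotonicity of the complex factor `F_e(λ; x)` in the vacancy probabilities `x` (all coefficients are
nonnegative for `λ ≥ 0`); the ingredient "`F_max` at all-`−`, `F_min` at all-`+`" of the S6(ii) proof sketch. -/
theorem cxWeight_mono (e : ZMod 2) {lam : ℝ} (hlam : 0 ≤ lam) {x x' : Fin 3 × ZMod 2 → ℝ}
    (hx : ∀ p, 0 ≤ x p) (hxx' : ∀ p, x p ≤ x' p) : cxWeight e lam x ≤ cxWeight e lam x' := by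
  unfold cxWeight
  refine Finset.sum_le_sum fun J _ => ?_
  split_ifs with hJ
  · refine mul_le_mul_of_nonneg_left ?_ (pow_nonneg hlam _)
    refine Finset.prod_le_prod (fun p _ => ?_) (fun p _ => ?_)
    · split_ifs
      · exact hx p
      · exact zero_le_one
    · split_ifs
      · exact hxx' p
      · exact le_rfl
  · exact le_rfl

/-- The product factor of a singleton independent set `{(i,a)}` is the single vacancy `x (i,a)`. -/
theorem prod_ite_mem_singleton (z : Fin 3 × ZMod 2 → ℝ) (p₀ : Fin 3 × ZMod 2) :
    (∏ p : Fin 3 × ZMod 2, (if (Sum.inl p : CxVert) ∈ ({Sum.inl p₀} : Finset CxVert) then z p else 1)) =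
      z p₀ := by
  rw [Finset.prod_eq_single p₀]
  · simp
  · intro p _ hp
    rw [if_neg]
    simpa using hp
  · intro h
    exact (h (Finset.mem_univ _)).elim

/-- STRICT monotonicity: for `λ > 0`, raising one vacancy probability strictly raises `F_e` strictly (the
singleton `{(i,a)}` is an independent set of the complex). -/
theorem cxWeight_strictMono (e : ZMod 2) {lam : ℝ} (hlam : 0 < lam) {x x' : Fin 3 × ZMod 2 → ℝ}
    (hx : ∀ p, 0 ≤ x p) (hxx' : ∀ p, x p ≤ x' p) {p₀ : Fin 3 × ZMod 2} (hp₀ : x p₀ < x' p₀) :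
    cxWeight e lam x < cxWeight e lam x' := by
  unfold cxWeight
  refine Finset.sum_lt_sum (fun J _ => ?_) ⟨{Sum.inl p₀}, Finset.mem_univ _, ?_⟩
  · split_ifs with hJ
    · refine mul_le_mul_of_nonneg_left ?_ (pow_nonneg hlam.le _)
      refine Finset.prod_le_prod (fun p _ => ?_) (fun p _ => ?_)
      · split_ifs
        · exact hx p
        · exact zero_le_one
      · split_ifs
        · exact hxx' p
        · exact le_rfl
    · exact le_rfl
  · have hind : (cxGraph e).IsIndepSet (↑({Sum.inl p₀} : Finset CxVert) : Set CxVert) := by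
      rw [Finset.coe_singleton, SimpleGraph.isIndepSet_iff]
      exact Set.pairwise_singleton _ _
    rw [if_pos hind, if_pos hind, Finset.card_singleton, pow_one, prod_ite_mem_singleton x p₀,
      prod_ite_mem_singleton x' p₀]
    exact mul_lt_mul_of_pos_left hp₀ hlam

/-- Hence the all-`−` phase pattern STRICTLY outweighs the reference pattern: `F₀ = cxW 0 ref < cxW 0 (all −)`
(vacancies `1 − q⁺ < 1 − q⁻`). -/
theorem cxW_ref_lt_allMinus {lam qp qm : ℝ} (hlam : 0 < lam) (hlt : qm < qp) (hqp : qp < 1) :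
    cxW lam qp qm 0 (fun p => decide (p.2 = 0)) < cxW lam qp qm 0 (fun _ => false) := by
  unfold cxW
  have h10 : (0 : ℝ) < (1 + lam) ^ 10 := pow_pos (by linarith) 10
  refine div_lt_div_of_pos_right ?_ h10
  refine cxWeight_strictMono 0 hlam (fun p => ?_) (fun p => ?_) (p₀ := ((0 : Fin 3), (0 : ZMod 2))) ?_
  · show 0 ≤ 1 - occP qp qm (decide (p.2 = 0))
    by_cases hp : p.2 = 0
    · simp only [hp, decide_true, occP, if_true]; linarith
    · simp only [hp, decide_false, occP]; norm_num; linarith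
  · show 1 - occP qp qm (decide (p.2 = 0)) ≤ 1 - occP qp qm false
    by_cases hp : p.2 = 0
    · simp only [hp, decide_true, occP, if_true]; norm_num; linarith
    · simp only [hp, decide_false, occP]; norm_num
  · show 1 - occP qp qm (decide (((0 : Fin 3), (0 : ZMod 2)).2 = 0)) < 1 - occP qp qm false
    simp only [decide_true, occP, if_true]; norm_num; linarith

/-- S6(ii) of the skeleton (`stub_energy`, second conjunct) with the SECTOR hypothesis
`K·D·log ρ_F ≤ κ₁·log B` DROPPED (everything else verbatim, over the landed `lgW`/`lgRef`). -/
def SectorOptWithoutCoupling : Prop :=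
  ∀ (lam qp qm : ℝ), 0 < lam → 0 < qm → qm < qp → qp < 1 →
    ∀ (nv m D K κ₁ : ℕ) (E : Fin m → Fin 3 → Fin nv),
      (∀ x : Fin nv, (Finset.univ.filter fun p : Fin m × Fin 3 => E p.1 p.2 = x).card ≤ D) →
      ∀ (b : Fin m → ZMod 2) (t : ℕ),
        (∀ f : Fin nv → ZMod 2,
          t ≤ (Finset.univ.filter fun e : Fin m => ∑ i : Fin 3, f (E e i) ≠ b e).card) →
        ∀ Y : Fin nv × ZMod 2 → Bool,
          lgW E lam qp qm κ₁ K b Y * Real.exp (K * t * (pwPsi lam qp qm 0 - pwPsi lam qp qm 1)) ≤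
            lgW E lam qp qm κ₁ K 0 lgRef

/-- **The sector hypothesis of S6(ii) is load-bearing**: without `K·D·log ρ_F ≤ κ₁·log B` the sector
optimisation FAILS at EVERY admissible `(λ, q⁺, q⁻)` — witness: one variable, one equation `x+x+x = 0`
(`D = 3`), `K = 1`, NO pair coupling `κ₁ = 0`, `b = 0`, `t = 0`, and the all-`−` phase vector, which outweighs
the reference vector by `cxW_ref_lt_allMinus`. (With the hypothesis, S6(ii) holds on paper: docblock §(d).) -/
theorem not_sectorOptWithoutCoupling : ¬ SectorOptWithoutCoupling := by
  intro h
  have key := h 1 (1 / 2) (1 / 4) one_pos (by norm_num) (by norm_num) (by norm_num) 1 1 3 1 0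
    (fun _ _ => 0) (fun x => (Finset.card_filter_le _ _).trans (by simp)) 0 0 (fun f => Nat.zero_le _)
    (fun _ => false)
  have hlt := cxW_ref_lt_allMinus (lam := 1) (qp := 1 / 2) (qm := 1 / 4) one_pos (by norm_num) (by norm_num)
  simp only [lgW, lgRef, pairW, pow_zero, Finset.prod_const_one, one_mul, Nat.cast_one, Nat.cast_zero,
    mul_zero, zero_mul, Real.exp_zero, mul_one, Fin.prod_univ_one, pow_one, Pi.zero_apply] at key
  exact absurd key (not_le.2 hlt)

end Targets

/-! ### (e) Near-misses (markers only; `sorry` permitted in this work file, nothing depends on them) -/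

/-- NEAR-MISS (not formalised): the all-`λ > 0` form is false UNCONDITIONALLY, by the cluster expansion at
small activity (`λ < 1/(e(Δ+1))`): truncated cluster sums of order `< k` are fixed linear combinations of
homomorphism counts from connected graphs on `< k` vertices (treewidth `< k`), and the tail is `≤ n(cλ)^k`, so
`C^k`-equivalent max-degree-`Δ` graphs have `|log Z_G − log Z_H| ≤ 2n(cλ)^k < δn` for large `k`. Obstruction:
no convergent cluster expansion / Kotecký–Preiss criterion for the hard-core polymer gas in the tree yet
(only the zero-freeness fact `PetersRegts2019_zeroFree` used by stmt-PneNP-2724). The CONDITIONAL version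
`false_without_threshold_of_densityContinuityBelow` is proved above. -/
theorem false_without_threshold : ¬ WithoutThreshold := by
  sorry

end Summit.PneNP.PneNP.Cruxes.MacroscopicTwinsAbove.Disproof
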